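import Summits.KontsevichZagierPeriods.KontsevichZagierPeriods.Theses.LinRedNormalForm
import Summits.KontsevichZagierPeriods.KontsevichZagierPeriods.Theorems.DihedralNormalForm.Negative.LoadBearing
import Summits.KontsevichZagierPeriods.KontsevichZagierPeriods.Theorems.LinRedNormalFormResidualBeyondGenusZeroOneRep
import Literature.NumberTheory.Transcendental.KZRelationsLE
import Literature.NumberTheory.Transcendental.KZSubcalculusInvariants
import Literature.Barriers.KontsevichZagierPeriods.GrothendieckPeriodConjectureDependence
import Literature.NumberTheory.Transcendental.KZLogCalculusProofs
import Summits.KontsevichZagierPeriods.KontsevichZagierPeriods.Theorems.MultiplicationAccessible.Negative.Core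
import Literature.Barriers.KontsevichZagierPeriods.AlgebraicPrimitivesObstruction
import Literature.NumberTheory.Transcendental.SemialgebraicMapsSmoothProofs
import Literature.NumberTheory.Transcendental.SemialgebraicMapsProofs

/-!
# Disproof of `ResidualBeyondGenusZero` (stmt-KontsevichZagierPeriods-3917) — findings

Crux (route LinRedNormalForm, the DECLARED RESIDUAL off the genus-zero sector):
`∀ c : KZ.FormalRep, eval c = 0 → ∃ c₀ ∈ closure GZ, c - c₀ ∈ KZ.relations`, `GZ` = the classes of
the absolutely convergent genus-zero representations `[Δ_k, P/(∏ tᵢ^{bᵢ} ∏ (1-tᵢ)^{cᵢ}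
∏_{i<j}(tᵢ-tⱼ)^{aᵢⱼ})]` (cdisprove seat, generation 1, 2026-08-16).

VERDICT OF THIS CYCLE: NO KILL, and none is accessible short of refuting the summit.
* §0 read-back (`gzSet`, `residual_iff`): no junk — denominators do not vanish on the open
  simplex, `k = 0` gives the rational constants (`ℝ⁰` has volume `1`), `eval c = 0` is satisfiable.
* §1 STRENGTH (tree file `…Theorems/LinRedNormalFormResidualBeyondGenusZeroStrength.lean`, not imported):
  `KontsevichZagierPeriods → ResidualBeyondGenusZero` unconditionally, and granted the sector
  cruxes the converse; so `¬ crux ⇒ ¬ summit`. A refutation is EXACTLY an additive invariant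
  `ι : FormalRep →+ A` killing the four move sets and every genus-zero class but not `ker eval`
  (`residualBeyondGenusZero_iff_invariant`, Forms file); the only known invariant of the four move
  sets is `eval` itself. Where the strength barriers bite: `residual_bites_oddZeta` (crux ∧ genus-zero
  kernel ⇒ `ζ(5) ∉ ℚ` and all `ζ(2k+1) ∉ ℚ`, modulo the printed implication
  `kzConjecture_implies_oddZetaAlgIndep`; robust to the 2026-08-16 route repair, which re-filed the
  sector kernel as `HoffmanSpanInKZ` + `HoffmanIndependence`).
* §2 THE HYPOTHESIS `eval c = 0` — dropping it (`ResidualWithoutEval`) is EQUIVALENT to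
  crux ∧ (`GZValuesExhaust`: every value of every representation — every real period and every real
  algebraic number — is a `ℤ`-combination of genus-zero values) (`residualWithoutEval_iff`).
  `GZValuesExhaust` is surely false (`√2`, `π`, `log 2` are not expected in the MZV span) but NOT
  refutable today: no specific real number that is a period is known to lie outside the `ℚ`-span of
  the multiple zeta values. Recorded as an open near-miss, not a `_false_without_` theorem.
* §3 RULE (3) IS LOAD-BEARING (certified): with `relations` replaced by the sub-calculus
  `(1a)+(1b)+(2)` the crux is FALSE (`residual_false_without_newtonLeibniz`): the dimension-graded
  evaluation `evalDim 0` kills that sub-calculus and is RATIONAL on `closure GZ`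
  (`exists_rat_evalDim_zero_of_mem_closure_gzSet`), while the vanishing combination
  `[pt, √2] − [Δ₁, √2]` has `evalDim 0 = √2 ∉ ℚ`.
* §4 ADDITIVITY IS LOAD-BEARING (certified, degenerate witness): with `relations` replaced by the
  sub-calculus `(2)+(3)` the crux is FALSE (`residual_false_without_additivity`): the number of
  EMPTY-domain generators `emptyCount` is an invariant of changes of variables (`Φ '' ∅ = ∅`) and of
  Newton–Leibniz moves (a band over `τ` is empty iff `τ` is, since `a ≤ b`), vanishes on `GZ`
  (simplices are inhabited), and is `1` on the vanishing combination `[∅]`. A non-degenerate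
  witness (`[r] + [−r]`, `value r = √2`) again needs "`√2` is not a genus-zero value" — open.
* §5 REFUTED STRENGTHENINGS: "on the nose" (`c ∈ closure GZ` itself, no moves) fails at `c = [∅]`
  (`not_residualOnTheNose`); UNIQUENESS of the normal form fails already at `c = 0`
  (`not_residualUnique`: `[Δ₀, 0] ∈ relations ⊓ closure GZ` is a non-zero genus-zero relation).
* §6 TRUNCATIONS ARE NOT WEAKER: for ANY generator family `S`, the `S`-residual is implied by
  `KZKernelConjecture` and implies it back as soon as `closure S ⊓ ker eval ≤ relations`
  (`residualFor_iff_kernel`); e.g. restricting the normal forms to the dimension-`0` constants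
  already gives back the full kernel conjecture (`residualFor_constants_iff_kernel`). So no
  dimension/weight truncation of the item is a cheaper target, and none is refutable short of the
  summit.
* §7 RULE (2) IS LOAD-BEARING (certified, NON-degenerate witness; the main theorem of this cycle):
  with `relations` replaced by the sub-calculus `(1a)+(1b)+(3)` the crux is FALSE
  (`residual_false_without_changeOfVariables`). Invariant: the FIRST-COORDINATE WINDOW CLASS
  `windowClass` = (`A ↦ ∫_{σ ∩ {x₀ ∈ A}} f` on measurable windows `A ⊆ ℝ`) modulo `primSpan`, the
  functionals `A ↦ ∫_{[a,b]∩A} ∂F` with a `ℚ`-SEMIALGEBRAIC primitive `F`; it kills (1a), (1b)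
  (restricted evaluation), (3) in dimensions `≥ 2` (the first coordinate is a base coordinate of
  every band: windowed soundness `setIntegral_band_inter_eq`) and (3) in dimension `1 → 0` (by the
  quotient); genus-zero classes have zero window evaluation off `(0,1)`. Witness
  `[[3,4], 1/(t−5)] − [[0,1], 1/(t−2)]` (a TRANSLATE pair, one change of variables; both
  `∫_{−2}^{−1}dx/x`): a normal form would make `1/(t−5)` a.e. the derivative of a `ℚ`-semialgebraic
  `F` on a rational interval in `(3,4)`; smoothness of semialgebraic functions off a nowhere dense
  set upgrades a.e. to everywhere, and an affine rescaling contradicts the barrier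
  `AlgebraicPrimitivesObstruction` (general simple-pole descent). TRANSLATION INVARIANCE IS NOT A
  CONSEQUENCE OF ADDITIVITY + NEWTON–LEIBNIZ + GENUS-ZERO CLASSES. (The infrastructure — windowed
  soundness, `primSpan` — is reusable for the pending rule-(2) claim of
  `DihedralNormalForm/Negative/LoadBearing.lean` §5, but there the witness must be genus-zero, the
  word densities live ON `(0,1)`, and a functional-transcendence input for polylogarithms modulo
  semialgebraic functions would replace the simple-pole barrier — not attempted here.)

LANDED under `Theorems/ResidualBeyondGenusZero/Negative/` (importable): `WindowInvariant.lean`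
(p90442, §7.1–7.3, 7.5: `windowEval`, `primSpan`, `windowClass`, `relationsWithoutCoV_le_ker_windowClass`,
`locallyPrimitive_of_mem_primSpan`), `RuleTwoLoadBearing.lean` (p91249, §7.4, 7.6–7.7:
`residual_false_without_changeOfVariables`); submitted: `LoadBearing.lean` (p94131, §§0, 3–5),
`RuleTwoOneMove.lean` (p94140, the one-move certificate); to follow: `Truncations.lean` (§§2, 6).

WHY IT RESISTS. Soundness makes `eval` an invariant; completeness (`ker eval ≤ relations ⊔ ⟨GZ⟩`)
can only fail through a SECOND invariant of all four move families, compatible with arbitrary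
`ℚ`-semialgebraic injective differentiable push-forwards, null-overlap dissections, integrand
splitting and fibre integration. Integrand additivity forces linearity in the density, domain
additivity kills lower-dimensional data, change of variables kills position/shape, and the
`1 → 0` Newton–Leibniz move pins every weighted evaluation to a constant weight (work-file analysis,
§4 docstring). Literature: no counterexample to Conjecture 1 in any form is in print; the theorem
sectors (1-motives, Huber–Wüstholz 2022 Thm 13.3; Ayoub's relative version 2015) are positive.
Barriers `kzConjecture_implies_{oddZetaAlgIndep, twoPiI_log_algIndep, ellipticPeriods_algIndep}`
are STRENGTH barriers (consequences), not falsity evidence.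
-/

noncomputable section

set_option linter.dupNamespace false

open MeasureTheory Set
open Literature.NumberTheory.Transcendental

namespace Summit.KontsevichZagierPeriods.KontsevichZagierPeriods.Cruxes.ResidualBeyondGenusZero.Disproof

open Summit.KontsevichZagierPeriods.KontsevichZagierPeriods.Theses.LinRedNormalForm
  (ResidualBeyondGenusZero DihedralNormalForm MzvKernelInKZ)
open Summit.KontsevichZagierPeriods.DihedralNormalForm.Negative
  (simplex gzIntegrand IsGenusZero evalDim evalDim_of relationsWithoutNL
    relationsWithoutNL_le_relations relationsWithoutNL_le_ker_evalDim oneRep oneRep_value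
    isGenusZero_oneRep relationsWithoutCoV)

/-! ## §0 Read-back: the generator set, named -/

/-- The genus-zero generator set of the crux: classes `[r]` of representations on the open ordered
simplex with a genus-zero integrand (`IsGenusZero`, from the `DihedralNormalForm` negative file). -/
def gzSet : Set KZ.FormalRep :=
  {x | ∃ (k : ℕ) (r : KZ.IntegralRep k), IsGenusZero r ∧ x = KZ.of r}

/-- `gzSet` is, on the nose, the set inlined in the route decl. -/
theorem gzSet_eq : gzSet = {x : KZ.FormalRep | ∃ (k : ℕ) (r : KZ.IntegralRep k)
    (p : MvPolynomial (Fin k) ℚ) (a : Fin k → Fin k → ℕ) (b c : Fin k → ℕ),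
    r.domain = {t | (∀ i, 0 < t i) ∧ (∀ i, t i < 1) ∧ StrictAnti t} ∧
    Set.EqOn r.integrand (fun t => MvPolynomial.aeval t p / ((∏ i, t i ^ b i) *
      (∏ i, (1 - t i) ^ c i) * ∏ i, ∏ j, if i < j then (t i - t j) ^ a i j else 1))
      r.domain ∧ x = KZ.of r} := by
  ext x
  constructor
  · rintro ⟨k, r, ⟨p, a, b, c, hdom, hint⟩, rfl⟩
    exact ⟨k, r, p, a, b, c, hdom, hint, rfl⟩
  · rintro ⟨k, r, p, a, b, c, hdom, hint, rfl⟩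
    exact ⟨k, r, ⟨p, a, b, c, hdom, hint⟩, rfl⟩

/-- READ-BACK: the crux says `ker eval ⊆ relations + closure gzSet`, elementwise. -/
theorem residual_iff : ResidualBeyondGenusZero ↔
    ∀ c : KZ.FormalRep, KZ.eval c = 0 →
      ∃ c₀ ∈ AddSubgroup.closure gzSet, c - c₀ ∈ KZ.relations := by
  rw [gzSet_eq]
  exact Iff.rfl

/-- The open ordered simplex is inhabited in every dimension (point `tᵢ = 1/(i+2)`), so no
genus-zero generator has empty domain. -/
theorem simplex_nonempty (k : ℕ) : (simplex k).Nonempty := by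
  refine ⟨fun i => 1 / (((i : ℕ) : ℝ) + 2), fun i => by positivity, fun i => ?_, fun i j hij => ?_⟩
  · rw [div_lt_one (by positivity)]
    have : (0 : ℝ) ≤ ((i : ℕ) : ℝ) := Nat.cast_nonneg _
    linarith
  · have h : ((i : ℕ) : ℝ) < ((j : ℕ) : ℝ) := by exact_mod_cast hij
    exact one_div_lt_one_div_of_lt (by positivity) (by linarith)

/-- A genus-zero representation of dimension `0` evaluates to a rational number (the constant
coefficient of its numerator: `ℝ⁰` is one point of volume `1`, all products are empty). -/
theorem exists_rat_value_eq_of_isGenusZero_zero {s : KZ.IntegralRep 0} (hs : IsGenusZero s) :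
    ∃ q : ℚ, s.value = q := by
  obtain ⟨p, a, b, c, hdom, hint⟩ := hs
  refine ⟨MvPolynomial.coeff 0 p, ?_⟩
  have volume_univ_fin_zero : volume (univ : Set (Fin 0 → ℝ)) = 1 := by
    rw [volume_pi, Measure.pi_univ]; simp
  have simplex_zero : simplex 0 = univ := by
    ext t
    simp only [simplex, mem_setOf_eq, mem_univ, iff_true]
    exact ⟨fun i => i.elim0, fun i => i.elim0, fun i => i.elim0⟩
  have hp : ∀ t : Fin 0 → ℝ, MvPolynomial.aeval t p = ((MvPolynomial.coeff 0 p : ℚ) : ℝ) := by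
    intro t
    conv_lhs => rw [MvPolynomial.eq_C_of_isEmpty p]
    simp
  have hfun : s.integrand = fun _ => ((MvPolynomial.coeff 0 p : ℚ) : ℝ) := by
    funext t
    have ht : t ∈ s.domain := by rw [hdom, simplex_zero]; trivial
    rw [hint ht]
    simp [gzIntegrand, hp]
  rw [KZ.IntegralRep.value, hdom, simplex_zero, Measure.restrict_univ, hfun, integral_const,
    measureReal_def, volume_univ_fin_zero]
  simp

/-! ## §3 Rule (3) is load-bearing: the residual fails in the sub-calculus (1a)+(1b)+(2)

`evalDim 0` (value of the dimension-`0` part) is an invariant of the additivity and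
change-of-variables moves (they act inside one dimension and are sound), and on the genus-zero
closure it takes RATIONAL values (dimension-`0` genus-zero representations are the rational
constants; higher-dimensional ones do not contribute). The vanishing combination
`c = [pt, √2] − [Δ₁, √2]` (the constant `√2` in dimension `0` minus the constant integrand `√2`
over `(0,1)`) has `evalDim 0 c = √2`: irrational. Hence `c - c₀ ∉ relationsWithoutNL` for every
`c₀ ∈ closure gzSet`: any move chain realising the residual for `c` uses Newton–Leibniz. -/

/-- The crux with `KZ.relations` replaced by the sub-calculus generated by (1a), (1b), (2). -/
def ResidualWithoutNewtonLeibniz : Prop :=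
  ∀ c : KZ.FormalRep, KZ.eval c = 0 →
    ∃ c₀ ∈ AddSubgroup.closure gzSet, c - c₀ ∈ relationsWithoutNL

/-- `evalDim 0` is rational on the genus-zero closure. -/
theorem exists_rat_evalDim_zero_of_mem_closure_gzSet {c₀ : KZ.FormalRep}
    (h : c₀ ∈ AddSubgroup.closure gzSet) : ∃ q : ℚ, evalDim 0 c₀ = q := by
  induction h using AddSubgroup.closure_induction with
  | mem x hx =>
    obtain ⟨k, r, hr, rfl⟩ := hx
    rw [evalDim_of]
    split_ifs with hk
    · subst hk
      exact exists_rat_value_eq_of_isGenusZero_zero hr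
    · exact ⟨0, by simp⟩
  | zero => exact ⟨0, by simp⟩
  | add x y _ _ hx hy =>
    obtain ⟨q, hq⟩ := hx
    obtain ⟨q', hq'⟩ := hy
    exact ⟨q + q', by simp [hq, hq']⟩
  | neg x _ hx =>
    obtain ⟨q, hq⟩ := hx
    exact ⟨-q, by simp [hq]⟩

/-- `√2` is algebraic over `ℚ` (root of `X² − 2`), so `[σ, √2·f]` is again a representation. -/
theorem isAlgebraic_sqrt_two : IsAlgebraic ℚ (Real.sqrt 2) := by
  refine ⟨Polynomial.X ^ 2 - Polynomial.C 2, Polynomial.X_pow_sub_C_ne_zero (by norm_num) 2, ?_⟩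
  have h2 : Real.sqrt 2 ^ 2 = 2 := Real.sq_sqrt (by norm_num)
  simp [h2]

/-- **Rule (3) is load-bearing for the residual.** -/
theorem residual_false_without_newtonLeibniz : ¬ ResidualWithoutNewtonLeibniz := by
  intro h
  obtain ⟨r₁, ⟨hdom, hint⟩, hval⟩ :=
    _root_.Summit.KontsevichZagierPeriods.ResidualBeyondGenusZero.exists_genusZero_value_eq_ratCast 1
  -- the dimension-0 constant √2 and the dimension-1 constant √2 over (0,1)
  set A : KZ.IntegralRep 0 := r₁.constMul (Real.sqrt 2) isAlgebraic_sqrt_two with hA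
  set B : KZ.IntegralRep 1 := oneRep.constMul (Real.sqrt 2) isAlgebraic_sqrt_two with hB
  have hvA : A.value = Real.sqrt 2 := by
    rw [hA, KZ.IntegralRep.value_constMul, hval]; simp
  have hvB : B.value = Real.sqrt 2 := by
    rw [hB, KZ.IntegralRep.value_constMul, oneRep_value, mul_one]
  obtain ⟨c₀, hc₀, hrel⟩ := h (KZ.of A - KZ.of B) (by simp [hvA, hvB])
  have h0 : evalDim 0 (KZ.of A - KZ.of B - c₀) = 0 :=
    (AddMonoidHom.mem_ker).1 (relationsWithoutNL_le_ker_evalDim 0 hrel)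
  obtain ⟨q, hq⟩ := exists_rat_evalDim_zero_of_mem_closure_gzSet hc₀
  rw [map_sub, map_sub, evalDim_of, evalDim_of, hq, hvA] at h0
  simp only [↓reduceIte, Nat.one_ne_zero, sub_zero] at h0
  exact irrational_sqrt_two ⟨q, by linarith⟩

/-! ## §4 Additivity is load-bearing: the residual fails in the sub-calculus (2)+(3)

The invariant: `emptyCount [r] = 1` if `r.domain = ∅`, else `0`. A change of variables has
`r'.domain = Φ '' r.domain`, empty iff `r.domain` is; a Newton–Leibniz move has `r.domain` = the
band over `r'.domain` with `a ≤ b`, empty iff `r'.domain` is. Genus-zero domains are inhabited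
simplices. The vanishing combination `[∅]` (`KZ.IntegralRep.empty 0`) has `emptyCount = 1`, so
`[∅] - c₀` is never in the sub-calculus (2)+(3): disposing of a null representation needs an
additivity move (indeed `[∅] = −([∅] − [∅] − [∅]) ∈ relations` by (1a)). The witness is
degenerate on purpose: for the natural witness `[r] + [r.neg]` (`value r = √2`) every invariant
of (2)+(3) we can evaluate factors through the VALUES of the generators, and excluding a
genus-zero correction then needs "`√2` is not a genus-zero value", an open transcendence
statement (cf. §2). -/

/-- The sub-calculus WITHOUT the additivity moves: generated by (2) and (3) only. -/
def relationsWithoutAdditivity : AddSubgroup KZ.FormalRep :=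
  AddSubgroup.closure (KZ.changeOfVariablesRel ∪ KZ.newtonLeibnizRel)

/-- The sub-calculus (2)+(3) is part of `KZ.relations`. -/
theorem relationsWithoutAdditivity_le_relations : relationsWithoutAdditivity ≤ KZ.relations := by
  refine AddSubgroup.closure_mono ?_
  rintro c (hc | hc)
  · exact Or.inl (Or.inr hc)
  · exact Or.inr hc

open scoped Classical in
/-- The number of generators with EMPTY domain (with multiplicity). -/
def emptyCount : KZ.FormalRep →+ ℤ :=
  FreeAbelianGroup.lift fun p => if p.2.domain = ∅ then 1 else 0

theorem emptyCount_of_eq {n : ℕ} {r : KZ.IntegralRep n} (h : r.domain = ∅) :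
    emptyCount (KZ.of r) = 1 := by
  simp [emptyCount, KZ.of, h]

theorem emptyCount_of_ne {n : ℕ} {r : KZ.IntegralRep n} (h : r.domain ≠ ∅) :
    emptyCount (KZ.of r) = 0 := by
  simp [emptyCount, KZ.of, h]

/-- **`emptyCount` is an invariant of the moves (2) and (3).** -/
theorem relationsWithoutAdditivity_le_ker_emptyCount :
    relationsWithoutAdditivity ≤ emptyCount.ker := by
  refine (AddSubgroup.closure_le _).mpr ?_
  rintro c (hc | hc)
  · obtain ⟨n, r, r', Φ, Φ', -, -, -, hdom, -, rfl⟩ := hc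
    rw [SetLike.mem_coe, AddMonoidHom.mem_ker, map_sub, sub_eq_zero]
    by_cases h : r.domain = ∅
    · rw [emptyCount_of_eq h, emptyCount_of_eq (by rw [hdom, h, image_empty])]
    · have h' : r'.domain ≠ ∅ := by
        rw [hdom]
        exact nonempty_iff_ne_empty.1 ((nonempty_iff_ne_empty.2 h).image Φ)
      rw [emptyCount_of_ne h, emptyCount_of_ne h']
  · obtain ⟨n, r, r', a, b, F, -, -, -, hab, hdom, -, -, -, rfl⟩ := hc
    rw [SetLike.mem_coe, AddMonoidHom.mem_ker, map_sub, sub_eq_zero]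
    by_cases h : r'.domain = ∅
    · have h' : r.domain = ∅ := by
        rw [hdom]
        ext z
        simp [h]
      rw [emptyCount_of_eq h', emptyCount_of_eq h]
    · obtain ⟨x, hx⟩ := nonempty_iff_ne_empty.2 h
      have h' : r.domain ≠ ∅ := by
        rw [hdom]
        refine nonempty_iff_ne_empty.1 ⟨Fin.snoc x (a x), ?_⟩
        simp only [mem_setOf_eq, Fin.init_snoc, Fin.snoc_last]
        exact ⟨hx, le_rfl, hab x hx⟩
      rw [emptyCount_of_ne h', emptyCount_of_ne h]

/-- **`emptyCount` vanishes on the genus-zero closure** (simplices are inhabited). -/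
theorem closure_gzSet_le_ker_emptyCount : AddSubgroup.closure gzSet ≤ emptyCount.ker := by
  refine (AddSubgroup.closure_le _).mpr ?_
  rintro x ⟨k, r, ⟨p, a, b, c, hdom, -⟩, rfl⟩
  rw [SetLike.mem_coe, AddMonoidHom.mem_ker, emptyCount_of_ne]
  rw [hdom]
  exact nonempty_iff_ne_empty.1 (simplex_nonempty k)

/-- The crux with `KZ.relations` replaced by the sub-calculus generated by (2), (3). -/
def ResidualWithoutAdditivity : Prop :=
  ∀ c : KZ.FormalRep, KZ.eval c = 0 →
    ∃ c₀ ∈ AddSubgroup.closure gzSet, c - c₀ ∈ relationsWithoutAdditivity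

/-- **Additivity is load-bearing for the residual** (witness `[∅]`). -/
theorem residual_false_without_additivity : ¬ ResidualWithoutAdditivity := by
  intro h
  obtain ⟨c₀, hc₀, hrel⟩ := h (KZ.of (KZ.IntegralRep.empty 0)) (by simp)
  have h1 := (AddMonoidHom.mem_ker).1 (relationsWithoutAdditivity_le_ker_emptyCount hrel)
  rw [map_sub, emptyCount_of_eq (KZ.IntegralRep.domain_empty),
    (AddMonoidHom.mem_ker).1 (closure_gzSet_le_ker_emptyCount hc₀)] at h1
  norm_num at h1


/-! ## §5 Refuted strengthenings

(a) ON THE NOSE: "every vanishing combination IS a genus-zero combination" (no moves) fails at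
`c = [∅]` (`emptyCount`). (b) UNIQUENESS of the normal form fails at `c = 0`: the genus-zero ZERO
representation `[Δ₀, 0]` is a non-zero element of `relations ⊓ closure gzSet` (integrand
additivity `[Δ₀,0] − [Δ₀,0] − [Δ₀,0]`), so both `0` and `[Δ₀,0]` are normal forms of `0`. Normal
forms are classes in `closure gzSet ⧸ (relations ⊓ closure gzSet)`, never elements. -/

/-- Strengthening (a): vanishing combinations are genus-zero combinations on the nose. -/
def ResidualOnTheNose : Prop :=
  ∀ c : KZ.FormalRep, KZ.eval c = 0 → c ∈ AddSubgroup.closure gzSet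

/-- **(a) is false**: `[∅]` vanishes and is no genus-zero combination. -/
theorem not_residualOnTheNose : ¬ ResidualOnTheNose := by
  intro h
  have h1 := (AddMonoidHom.mem_ker).1
    (closure_gzSet_le_ker_emptyCount (h (KZ.of (KZ.IntegralRep.empty 0)) (by simp)))
  rw [emptyCount_of_eq KZ.IntegralRep.domain_empty] at h1
  exact one_ne_zero h1

/-- A genus-zero representation which is itself a relation: `[Δ₀, 0]` (numerator `P = 0`). -/
theorem exists_isGenusZero_of_mem_relations :
    ∃ r : KZ.IntegralRep 0, IsGenusZero r ∧ KZ.of r ∈ KZ.relations := by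
  obtain ⟨r, ⟨hdom, hint⟩, -⟩ :=
    _root_.Summit.KontsevichZagierPeriods.ResidualBeyondGenusZero.exists_genusZero_value_eq_ratCast 0
  refine ⟨r, ⟨MvPolynomial.C 0, 0, 0, 0, hdom, hint⟩, ?_⟩
  refine KZ.of_mem_relations_of_eqOn_zero r fun x hx => ?_
  have := hint hx
  simpa using this

/-- Strengthening (b): the genus-zero normal form is unique. -/
def ResidualUnique : Prop :=
  ∀ c : KZ.FormalRep, KZ.eval c = 0 →
    ∃! c₀, c₀ ∈ AddSubgroup.closure gzSet ∧ c - c₀ ∈ KZ.relations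

/-- **(b) is false** already at `c = 0` (`0` and `[Δ₀, 0]` are both normal forms; they differ
since `coeffSum [Δ₀,0] = 1`). -/
theorem not_residualUnique : ¬ ResidualUnique := by
  intro h
  obtain ⟨r, hr, hrel⟩ := exists_isGenusZero_of_mem_relations
  obtain ⟨c₀, -, huniq⟩ := h 0 (map_zero _)
  have h0 : (0 : KZ.FormalRep) = c₀ := huniq 0 ⟨zero_mem _, by simp⟩
  have h1 : KZ.of r = c₀ :=
    huniq (KZ.of r) ⟨AddSubgroup.subset_closure ⟨0, r, hr, rfl⟩,
      by simpa using KZ.relations.neg_mem hrel⟩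
  have : KZ.coeffSum (KZ.of r) = KZ.coeffSum 0 := by rw [h1, ← h0]
  simp at this

/-- The positive content behind (b): `relations ⊓ closure gzSet ≠ ⊥`. -/
theorem relations_inf_closure_gzSet_ne_bot :
    KZ.relations ⊓ AddSubgroup.closure gzSet ≠ ⊥ := by
  obtain ⟨r, hr, hrel⟩ := exists_isGenusZero_of_mem_relations
  intro h
  have hmem : KZ.of r ∈ KZ.relations ⊓ AddSubgroup.closure gzSet :=
    ⟨hrel, AddSubgroup.subset_closure ⟨0, r, hr, rfl⟩⟩
  rw [h, AddSubgroup.mem_bot] at hmem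
  have : KZ.coeffSum (KZ.of r) = 0 := by rw [hmem, map_zero]
  simp at this

/-! ## §2 The hypothesis `eval c = 0`

Dropping it gives `ResidualWithoutEval`: EVERY formal combination is a genus-zero combination modulo
the moves. By soundness and the bookkeeping `KZ.exists_integralRep_sub_holds` this is EQUIVALENT to
the crux together with `GZValuesExhaust` (every value of every representation is a `ℤ`-combination
of genus-zero values). `GZValuesExhaust` would put `√2`, `π`, `log 2`, every real period and every
real algebraic number in the `ℤ`-span of the genus-zero values (⊆ the `ℚ`-span of the MZVs by
Brown's theorem); it is certainly false and certainly not refutable today (no specific real period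
is known to lie outside the `ℚ`-span of the MZVs). So the hypothesis is load-bearing "morally" but
no `_false_without_eval` theorem can be certified; recorded as an open near-miss (no `sorry`). -/

/-- Every value of every integral representation is a `ℤ`-combination of genus-zero values. -/
def GZValuesExhaust : Prop :=
  ∀ (n : ℕ) (r : KZ.IntegralRep n), ∃ c₀ ∈ AddSubgroup.closure gzSet, r.value = KZ.eval c₀

/-- The crux with the hypothesis `eval c = 0` dropped. -/
def ResidualWithoutEval : Prop :=
  ∀ c : KZ.FormalRep, ∃ c₀ ∈ AddSubgroup.closure gzSet, c - c₀ ∈ KZ.relations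

/-- **Dropping `eval c = 0` = crux ∧ (all values are genus-zero values).** -/
theorem residualWithoutEval_iff :
    ResidualWithoutEval ↔ ResidualBeyondGenusZero ∧ GZValuesExhaust := by
  rw [residual_iff]
  constructor
  · intro h
    refine ⟨fun c _ => h c, fun n r => ?_⟩
    obtain ⟨c₀, hc₀, hrel⟩ := h (KZ.of r)
    refine ⟨c₀, hc₀, ?_⟩
    have h0 := (AddMonoidHom.mem_ker).1 (KZ.relations_le_ker_eval_holds hrel)
    rwa [map_sub, KZ.eval_of, sub_eq_zero] at h0
  · rintro ⟨hRES, hV⟩ c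
    obtain ⟨n, m, r, r', hc⟩ := KZ.exists_integralRep_sub_holds c
    obtain ⟨c₁, hc₁, h₁⟩ := hV n r
    obtain ⟨c₂, hc₂, h₂⟩ := hV m r'
    have hev : KZ.eval (c - (c₁ - c₂)) = 0 := by
      have h0 := (AddMonoidHom.mem_ker).1 (KZ.relations_le_ker_eval_holds hc)
      rw [map_sub, sub_eq_zero] at h0
      rw [map_sub, map_sub, h0, map_sub, KZ.eval_of, KZ.eval_of, h₁, h₂, sub_self]
    obtain ⟨c₃, hc₃, h₃⟩ := hRES _ hev
    refine ⟨c₁ - c₂ + c₃, add_mem (sub_mem hc₁ hc₂) hc₃, ?_⟩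
    have : c - (c₁ - c₂ + c₃) = c - (c₁ - c₂) - c₃ := by abel
    rwa [this]

/-- What `GZValuesExhaust` would assert at the cheapest witness: `√2` (a dimension-`0` value) is a
`ℤ`-combination of genus-zero values — an open transcendence statement. -/
theorem sqrt_two_mem_of_gzValuesExhaust (h : GZValuesExhaust) :
    ∃ c₀ ∈ AddSubgroup.closure gzSet, KZ.eval c₀ = Real.sqrt 2 := by
  obtain ⟨r₁, -, hval⟩ :=
    _root_.Summit.KontsevichZagierPeriods.ResidualBeyondGenusZero.exists_genusZero_value_eq_ratCast 1
  obtain ⟨c₀, hc₀, h0⟩ := h 0 (r₁.constMul (Real.sqrt 2) isAlgebraic_sqrt_two)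
  refine ⟨c₀, hc₀, ?_⟩
  rw [← h0, KZ.IntegralRep.value_constMul, hval]
  simp

/-! ## §6 Truncations and torsion are not weaker

For ANY family `S` of "normal form" generators the `S`-residual is implied by `KZKernelConjecture`
(`c₀ = 0`) and gives it back as soon as the vanishing `S`-combinations are relations
(`residualFor_iff_kernel`). The dimension-`0` genus-zero generators (the rational constants) already
satisfy this (`mem_relations_of_mem_closure_gzConstSet`): restricting the normal forms of the item to
CONSTANTS is equivalent to the full kernel conjecture (`residualFor_constants_iff_kernel`), hence
(sandwich) so is every family between the constants and any `S` with the kernel property. No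
dimension / weight truncation of the item is a cheaper or a refutable target. Likewise allowing a
positive integer multiple (`ResidualUpToTorsion`) changes nothing: `relations` is saturated and
`closure gzSet` is stable under the scaling `[σ,f] ↦ [σ, f/k]` (`residualUpToTorsion_iff`). -/

/-- The residual for an arbitrary family `S` of normal-form generators. -/
def ResidualFor (S : Set KZ.FormalRep) : Prop :=
  ∀ c : KZ.FormalRep, KZ.eval c = 0 → ∃ c₀ ∈ AddSubgroup.closure S, c - c₀ ∈ KZ.relations

/-- The item is `ResidualFor gzSet`. -/
theorem residual_iff_residualFor : ResidualBeyondGenusZero ↔ ResidualFor gzSet := residual_iff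

/-- Upper end of the sandwich: the kernel conjecture gives every `S`-residual. -/
theorem residualFor_of_kernel (S : Set KZ.FormalRep) (hK : KZKernelConjecture) : ResidualFor S :=
  fun c hc => ⟨0, zero_mem _, by simpa using hK c hc⟩

/-- `ResidualFor` is monotone in the family. -/
theorem residualFor_mono {S T : Set KZ.FormalRep} (h : S ⊆ T) (hS : ResidualFor S) :
    ResidualFor T := fun c hc =>
  let ⟨c₀, hc₀, hrel⟩ := hS c hc
  ⟨c₀, AddSubgroup.closure_mono h hc₀, hrel⟩

/-- **The sandwich closes** whenever the vanishing `S`-combinations are relations. -/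
theorem residualFor_iff_kernel {S : Set KZ.FormalRep}
    (hS : ∀ c₀ ∈ AddSubgroup.closure S, KZ.eval c₀ = 0 → c₀ ∈ KZ.relations) :
    ResidualFor S ↔ KZKernelConjecture := by
  constructor
  · intro h c hc
    obtain ⟨c₀, hc₀, hrel⟩ := h c hc
    have h0 := (AddMonoidHom.mem_ker).1 (KZ.relations_le_ker_eval_holds hrel)
    rw [map_sub, hc, zero_sub, neg_eq_zero] at h0
    have := add_mem hrel (hS c₀ hc₀ h0)
    rwa [sub_add_cancel] at this
  · exact residualFor_of_kernel S

/-- The dimension-`0` genus-zero generators: the rational constants `[Δ₀, q]`. -/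
def gzConstSet : Set KZ.FormalRep :=
  {x | ∃ r : KZ.IntegralRep 0, IsGenusZero r ∧ x = KZ.of r}

/-- The constants are genus-zero generators. -/
theorem gzConstSet_subset_gzSet : gzConstSet ⊆ gzSet := by
  rintro x ⟨r, hr, rfl⟩
  exact ⟨0, r, hr, rfl⟩

/-- A chosen constant representation `[Δ₀, q]` for each rational `q`. -/
theorem exists_constRep : ∀ q : ℚ, ∃ r : KZ.IntegralRep 0, IsGenusZero r ∧
    (∀ x ∈ r.domain, r.integrand x = q) ∧ r.value = q := by
  intro q
  obtain ⟨r, ⟨hdom, hint⟩, hval⟩ :=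
    _root_.Summit.KontsevichZagierPeriods.ResidualBeyondGenusZero.exists_genusZero_value_eq_ratCast q
  refine ⟨r, ⟨MvPolynomial.C q, 0, 0, 0, hdom, hint⟩, fun x hx => ?_, hval⟩
  have := hint hx
  simpa using this

/-- Two dimension-`0` genus-zero representations have the same domain `Δ₀ = ℝ⁰`. -/
theorem domain_eq_of_isGenusZero_zero {r r' : KZ.IntegralRep 0} (hr : IsGenusZero r)
    (hr' : IsGenusZero r') : r'.domain = r.domain := by
  obtain ⟨_, _, _, _, hd, _⟩ := hr
  obtain ⟨_, _, _, _, hd', _⟩ := hr'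
  rw [hd, hd']

/-- **Vanishing combinations of constants are relations** (the constants form a copy of `ℚ`
modulo integrand additivity): every `c₀ ∈ closure gzConstSet` is congruent to one constant
`[Δ₀, q]` with `q = eval c₀`. -/
theorem mem_relations_of_mem_closure_gzConstSet {c₀ : KZ.FormalRep}
    (h : c₀ ∈ AddSubgroup.closure gzConstSet) (h0 : KZ.eval c₀ = 0) : c₀ ∈ KZ.relations := by
  choose R hR using exists_constRep
  -- every element of the closure is congruent to a single constant
  have key : ∀ c ∈ AddSubgroup.closure gzConstSet, ∃ q : ℚ, c - KZ.of (R q) ∈ KZ.relations := by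
    intro c hc
    induction hc using AddSubgroup.closure_induction with
    | mem x hx =>
      obtain ⟨r, hr, rfl⟩ := hx
      obtain ⟨q, hq⟩ := exists_rat_value_eq_of_isGenusZero_zero hr
      refine ⟨q, KZ.of_sub_of_mem_relations_of_eqOn
        (domain_eq_of_isGenusZero_zero hr (hR q).1) fun x hx => ?_⟩
      -- both integrands are the constant q on the (one-point) domain
      have hx' : x ∈ (R q).domain := by rwa [domain_eq_of_isGenusZero_zero hr (hR q).1]
      rw [(hR q).2.1 x hx']
      obtain ⟨p, a, b, e, hdom, hint⟩ := hr
      -- value of r is its integrand at the unique point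
      have hsub : Subsingleton (Fin 0 → ℝ) := inferInstance
      have hval : r.value = r.integrand x := by
        have volume_univ_fin_zero : volume (univ : Set (Fin 0 → ℝ)) = 1 := by
          rw [volume_pi, Measure.pi_univ]; simp
        have hdu : r.domain = univ := by
          rw [hdom]; ext t
          simp only [simplex, mem_setOf_eq, mem_univ, iff_true]
          exact ⟨fun i => i.elim0, fun i => i.elim0, fun i => i.elim0⟩
        have hfun : r.integrand = fun _ => r.integrand x := by
          funext t; rw [Subsingleton.elim t x]
        rw [KZ.IntegralRep.value, hdu, Measure.restrict_univ, hfun, integral_const, measureReal_def,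
          volume_univ_fin_zero]
        simp
      rw [← hval, hq]
    | zero =>
      refine ⟨0, ?_⟩
      rw [zero_sub]
      exact KZ.relations.neg_mem (KZ.of_mem_relations_of_eqOn_zero _ fun x hx => by
        simp [(hR 0).2.1 x hx])
    | add x y _ _ hx hy =>
      obtain ⟨q, hq⟩ := hx
      obtain ⟨q', hq'⟩ := hy
      refine ⟨q + q', ?_⟩
      have hadd : KZ.of (R (q + q')) - KZ.of (R q) - KZ.of (R q') ∈ KZ.relations :=
        KZ.integrandAddRel_subset_relations ⟨0, R (q + q'), R q, R q',
          domain_eq_of_isGenusZero_zero (hR _).1 (hR _).1,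
          domain_eq_of_isGenusZero_zero (hR _).1 (hR _).1, fun z hz => by
            have hzq : z ∈ (R q).domain := by
              rwa [domain_eq_of_isGenusZero_zero (hR (q + q')).1 (hR q).1]
            have hzq' : z ∈ (R q').domain := by
              rwa [domain_eq_of_isGenusZero_zero (hR (q + q')).1 (hR q').1]
            simp [(hR _).2.1 z hz, (hR _).2.1 z hzq, (hR _).2.1 z hzq'], rfl⟩
      have : x + y - KZ.of (R (q + q')) =
          (x - KZ.of (R q)) + (y - KZ.of (R q')) -
            (KZ.of (R (q + q')) - KZ.of (R q) - KZ.of (R q')) := by abel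
      rw [this]
      exact sub_mem (add_mem hq hq') hadd
    | neg x _ hx =>
      obtain ⟨q, hq⟩ := hx
      refine ⟨-q, ?_⟩
      have hadd : KZ.of (R 0) - KZ.of (R q) - KZ.of (R (-q)) ∈ KZ.relations :=
        KZ.integrandAddRel_subset_relations ⟨0, R 0, R q, R (-q),
          domain_eq_of_isGenusZero_zero (hR _).1 (hR _).1,
          domain_eq_of_isGenusZero_zero (hR _).1 (hR _).1, fun z hz => by
            have hzq : z ∈ (R q).domain := by
              rwa [domain_eq_of_isGenusZero_zero (hR 0).1 (hR q).1]
            have hzq' : z ∈ (R (-q)).domain := by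
              rwa [domain_eq_of_isGenusZero_zero (hR 0).1 (hR (-q)).1]
            simp [(hR _).2.1 z hz, (hR _).2.1 z hzq, (hR _).2.1 z hzq'], rfl⟩
      have hzero : KZ.of (R 0) ∈ KZ.relations :=
        KZ.of_mem_relations_of_eqOn_zero _ fun z hz => by simp [(hR 0).2.1 z hz]
      have : -x - KZ.of (R (-q)) = -(x - KZ.of (R q)) + (KZ.of (R 0) - KZ.of (R q) - KZ.of (R (-q)))
          - KZ.of (R 0) := by abel
      rw [this]
      exact sub_mem (add_mem (neg_mem hq) hadd) hzero
  obtain ⟨q, hq⟩ := key c₀ h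
  -- q = eval c₀ = 0, and [Δ₀, 0] is a relation
  have hq0 : (q : ℝ) = 0 := by
    have := (AddMonoidHom.mem_ker).1 (KZ.relations_le_ker_eval_holds hq)
    rw [map_sub, h0, KZ.eval_of, (hR q).2.2, zero_sub, neg_eq_zero] at this
    exact this
  have hRq : KZ.of (R q) ∈ KZ.relations :=
    KZ.of_mem_relations_of_eqOn_zero _ fun z hz => by rw [(hR q).2.1 z hz, hq0]; rfl
  have := add_mem hq hRq
  rwa [sub_add_cancel] at this

/-- **Restricting the normal forms to constants is already the kernel conjecture.** -/
theorem residualFor_constants_iff_kernel : ResidualFor gzConstSet ↔ KZKernelConjecture :=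
  residualFor_iff_kernel fun _ hc h0 => mem_relations_of_mem_closure_gzConstSet hc h0

/-- Hence the sandwich for the item itself (cf. the Strength file): constants-residual ⇒ item ⇒ …,
and everything collapses to `KZKernelConjecture` at the lower end. -/
theorem residual_of_residualFor_constants (h : ResidualFor gzConstSet) : ResidualBeyondGenusZero :=
  residual_iff_residualFor.2 (residualFor_mono gzConstSet_subset_gzSet h)

open Summit.KontsevichZagierPeriods.MultiplicationAccessible.Negative
  (isAlgebraic_inv_nat sub_nsmul_scale_inv_mem_relations) in
/-- `closure gzSet` is stable under the scaling `[σ, f] ↦ [σ, f/k]` (the numerator `P/k` is again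
a `ℚ`-polynomial). -/
theorem scale_inv_mem_closure_gzSet {k : ℕ} {c : KZ.FormalRep}
    (hc : c ∈ AddSubgroup.closure gzSet) :
    KZ.scale ((k : ℝ)⁻¹) (isAlgebraic_inv_nat k) c ∈ AddSubgroup.closure gzSet := by
  induction hc using AddSubgroup.closure_induction with
  | mem x hx =>
    obtain ⟨n, r, ⟨p, a, b, e, hdom, hint⟩, rfl⟩ := hx
    rw [KZ.scale_of]
    refine AddSubgroup.subset_closure ⟨n, r.constMul ((k : ℝ)⁻¹) (isAlgebraic_inv_nat k),
      ⟨MvPolynomial.C (k : ℚ)⁻¹ * p, a, b, e, hdom, ?_⟩, rfl⟩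
    intro t ht
    simp only [KZ.IntegralRep.integrand_constMul]
    rw [hint ht]
    simp only [gzIntegrand, map_mul, MvPolynomial.aeval_C, eq_ratCast, Rat.cast_inv,
      Rat.cast_natCast]
    ring
  | zero => simp
  | add x y _ _ hx hy => simpa using add_mem hx hy
  | neg x _ hx => simpa using neg_mem hx

/-- The item up to a positive integer multiple. -/
def ResidualUpToTorsion : Prop :=
  ∀ c : KZ.FormalRep, KZ.eval c = 0 →
    ∃ k : ℕ, k ≠ 0 ∧ ∃ c₀ ∈ AddSubgroup.closure gzSet, k • c - c₀ ∈ KZ.relations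

open Summit.KontsevichZagierPeriods.MultiplicationAccessible.Negative
  (isAlgebraic_inv_nat sub_nsmul_scale_inv_mem_relations) in
/-- **Torsion changes nothing**: a genus-zero normal form of `k • c` rescales to one of `c`. -/
theorem residualUpToTorsion_iff : ResidualUpToTorsion ↔ ResidualBeyondGenusZero := by
  rw [residual_iff]
  constructor
  · intro h c hc
    obtain ⟨k, hk, c₀, hc₀, hrel⟩ := h c hc
    refine ⟨KZ.scale ((k : ℝ)⁻¹) (isAlgebraic_inv_nat k) c₀, scale_inv_mem_closure_gzSet hc₀, ?_⟩
    have h1 := KZ.scale_mem_relations ((k : ℝ)⁻¹) (isAlgebraic_inv_nat k) hrel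
    rw [map_sub, map_nsmul] at h1
    have h2 := sub_nsmul_scale_inv_mem_relations hk c
    have : c - KZ.scale ((k : ℝ)⁻¹) (isAlgebraic_inv_nat k) c₀ =
        (c - k • KZ.scale ((k : ℝ)⁻¹) (isAlgebraic_inv_nat k) c) +
          (k • KZ.scale ((k : ℝ)⁻¹) (isAlgebraic_inv_nat k) c -
            KZ.scale ((k : ℝ)⁻¹) (isAlgebraic_inv_nat k) c₀) := by abel
    rw [this]
    exact add_mem h2 h1
  · intro h c hc
    obtain ⟨c₀, hc₀, hrel⟩ := h c hc
    exact ⟨1, one_ne_zero, c₀, hc₀, by simpa using hrel⟩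

/-! ## §7.1 Newton–Leibniz soundness over a measurable part of the base

The analytic core of `KZ.eval_eq_zero_of_mem_newtonLeibnizRel_holds`, localised: for a
Newton–Leibniz move `[band, ∂F/∂t] − [τ, F(b) − F(a)]` and ANY measurable `S ⊆ ℝⁿ`, the integral of
the band integrand over the part of the band lying over `τ ∩ S` equals the integral of
`F(b) − F(a)` over `τ ∩ S` (Fubini along the last coordinate + FTC on each fibre). -/

/-- Windowed Newton–Leibniz identity (the soundness computation over `τ ∩ S`). [folklore] -/
theorem setIntegral_band_inter_eq {n : ℕ} (r : KZ.IntegralRep (n + 1)) (r' : KZ.IntegralRep n)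
    (a b : (Fin n → ℝ) → ℝ) (F : (Fin (n + 1) → ℝ) → ℝ)
    (hab : ∀ x ∈ r'.domain, a x ≤ b x)
    (hdom : r.domain = {z | (Fin.init z : Fin n → ℝ) ∈ r'.domain ∧ a (Fin.init z) ≤ z (Fin.last n) ∧
      z (Fin.last n) ≤ b (Fin.init z)})
    (hcont : ∀ x ∈ r'.domain, ContinuousOn (fun t : ℝ => F (Fin.snoc x t)) (Icc (a x) (b x)))
    (hderiv : ∀ x ∈ r'.domain, ∀ t ∈ Ioo (a x) (b x),
      HasDerivAt (fun s : ℝ => F (Fin.snoc x s)) (r.integrand (Fin.snoc x t)) t)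
    (hr' : ∀ x ∈ r'.domain, r'.integrand x = F (Fin.snoc x (b x)) - F (Fin.snoc x (a x)))
    {S : Set (Fin n → ℝ)} (hS : MeasurableSet S) :
    ∫ z in r.domain ∩ {z | (Fin.init z : Fin n → ℝ) ∈ S}, r.integrand z =
      ∫ x in r'.domain ∩ S, r'.integrand x := by
  have hτm : MeasurableSet (r'.domain ∩ S) := (KZ.IntegralRep.measurableSet_domain_holds r').inter hS
  have hinitm : Measurable (fun z : Fin (n + 1) → ℝ => (Fin.init z : Fin n → ℝ)) :=
    measurable_pi_lambda _ fun i => measurable_pi_apply _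
  have hbm : MeasurableSet (r.domain ∩ {z | (Fin.init z : Fin n → ℝ) ∈ S}) :=
    (KZ.IntegralRep.measurableSet_domain_holds r).inter (hinitm hS)
  -- split off the last coordinate
  set e : (Fin (n + 1) → ℝ) ≃ᵐ ℝ × (Fin n → ℝ) :=
    MeasurableEquiv.piFinSuccAbove (fun _ => ℝ) (Fin.last n) with he_def
  have he : MeasurePreserving e volume volume :=
    volume_preserving_piFinSuccAbove (fun _ => ℝ) (Fin.last n)
  have he_symm : ∀ p : ℝ × (Fin n → ℝ), e.symm p = Fin.snoc p.2 p.1 := fun p => by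
    simp [he_def, MeasurableEquiv.piFinSuccAbove, Fin.snocEquiv]
  -- membership in the windowed band, fibrewise
  have hmem : ∀ x t, Fin.snoc x t ∈ r.domain ∩ {z | (Fin.init z : Fin n → ℝ) ∈ S} ↔
      x ∈ r'.domain ∩ S ∧ t ∈ Icc (a x) (b x) := by
    intro x t
    rw [hdom]
    simp only [mem_inter_iff, mem_setOf_eq, Fin.init_snoc, Fin.snoc_last, mem_Icc]
    tauto
  -- the integrand extended by zero off the windowed band, and its fibres
  set G : (Fin (n + 1) → ℝ) → ℝ := (r.domain ∩ {z | (Fin.init z : Fin n → ℝ) ∈ S}).indicator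
    r.integrand with hG_def
  have hG : Integrable G :=
    (integrable_indicator_iff hbm).mpr (r.integrableOn.mono_set inter_subset_left)
  have hfib_in : ∀ x ∈ r'.domain ∩ S, (fun t => G (Fin.snoc x t)) =
      (Icc (a x) (b x)).indicator (fun t => r.integrand (Fin.snoc x t)) := by
    intro x hx
    ext t
    by_cases ht : t ∈ Icc (a x) (b x)
    · rw [Set.indicator_of_mem ht, hG_def, Set.indicator_of_mem ((hmem x t).2 ⟨hx, ht⟩)]
    · rw [Set.indicator_of_notMem ht, hG_def,
        Set.indicator_of_notMem (fun h => ht ((hmem x t).1 h).2)]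
  have hfib_out : ∀ x ∉ r'.domain ∩ S, (fun t => G (Fin.snoc x t)) = fun _ => 0 := by
    intro x hx
    ext t
    rw [hG_def, Set.indicator_of_notMem (fun h => hx ((hmem x t).1 h).1)]
  have hG2 : Integrable (fun p : ℝ × (Fin n → ℝ) => G (Fin.snoc p.2 p.1))
      ((volume : Measure ℝ).prod (volume : Measure (Fin n → ℝ))) := by
    have h := ((he.symm e).integrable_comp_emb e.symm.measurableEmbedding (g := G)).mpr hG
    rw [← Measure.volume_eq_prod]
    convert h using 1
    ext p
    simp [he_symm]
  calc ∫ z in r.domain ∩ {z | (Fin.init z : Fin n → ℝ) ∈ S}, r.integrand z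
      = ∫ z, G z := (integral_indicator hbm).symm
    _ = ∫ p, G (e.symm p) := ((he.symm e).integral_comp' G).symm
    _ = ∫ p : ℝ × (Fin n → ℝ), G (Fin.snoc p.2 p.1) ∂(volume.prod volume) := by
        simp_rw [he_symm, Measure.volume_eq_prod]
    _ = ∫ x, ∫ t, G (Fin.snoc x t) := integral_prod_symm _ hG2
    _ = ∫ x, (r'.domain ∩ S).indicator
          (fun x => F (Fin.snoc x (b x)) - F (Fin.snoc x (a x))) x := by
        apply integral_congr_ae
        filter_upwards [hG2.prod_left_ae] with x hx
        by_cases hxτ : x ∈ r'.domain ∩ S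
        · rw [Set.indicator_of_mem hxτ, hfib_in x hxτ, integral_indicator measurableSet_Icc,
            integral_Icc_eq_integral_Ioc, ← intervalIntegral.integral_of_le (hab x hxτ.1)]
          apply intervalIntegral.integral_eq_sub_of_hasDerivAt_of_le (hab x hxτ.1) (hcont x hxτ.1)
            (hderiv x hxτ.1)
          rw [intervalIntegrable_iff_integrableOn_Icc_of_le (hab x hxτ.1)]
          have hx' : Integrable (fun t => G (Fin.snoc x t)) := hx
          rw [hfib_in x hxτ] at hx'
          exact (integrable_indicator_iff measurableSet_Icc).mp hx'
        · rw [Set.indicator_of_notMem hxτ]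
          rw [hfib_out x hxτ, integral_zero]
    _ = ∫ x in r'.domain ∩ S, (F (Fin.snoc x (b x)) - F (Fin.snoc x (a x))) :=
        integral_indicator hτm
    _ = ∫ x in r'.domain ∩ S, r'.integrand x :=
        (setIntegral_congr_fun hτm fun x hx => hr' x hx.1).symm

/-! ## §7.2 The first-coordinate window evaluation -/

/-- The window "first coordinate in `A`" in each dimension (empty in dimension `0`). -/
def firstWindow (A : Set ℝ) : (n : ℕ) → Set (Fin n → ℝ)
  | 0 => ∅
  | (_ + 1) => {x | x 0 ∈ A}

/-- No window in dimension `0`. -/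
@[simp] theorem firstWindow_zero (A : Set ℝ) : firstWindow A 0 = ∅ := rfl
/-- The window in positive dimension. -/
@[simp] theorem firstWindow_succ (A : Set ℝ) (m : ℕ) :
    firstWindow A (m + 1) = {x : Fin (m + 1) → ℝ | x 0 ∈ A} := rfl

/-- Windows over measurable sets are measurable. -/
theorem measurableSet_firstWindow {A : Set ℝ} (hA : MeasurableSet A) :
    ∀ n, MeasurableSet (firstWindow A n)
  | 0 => MeasurableSet.empty
  | (_ + 1) => measurable_pi_apply 0 hA

/-- In dimension `m + 2` the first-coordinate window is the cylinder over the window in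
dimension `m + 1` (the first coordinate is a base coordinate of every Newton–Leibniz band). -/
theorem firstWindow_succ_succ_eq (A : Set ℝ) (m : ℕ) :
    firstWindow A (m + 2) = {z : Fin (m + 2) → ℝ | (Fin.init z : Fin (m + 1) → ℝ) ∈ firstWindow A (m + 1)} := by
  ext z
  simp [firstWindow, Fin.init]

/-- Measurable windows on the first coordinate axis. -/
abbrev MSet : Type := {A : Set ℝ // MeasurableSet A}

/-- The first-coordinate window evaluation: `[r] ↦ (A ↦ ∫_{r.domain ∩ {x₀ ∈ A}} f)` on measurable
windows `A ⊆ ℝ`, zero on dimension `0`. -/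
def windowEval : KZ.FormalRep →+ (MSet → ℝ) :=
  FreeAbelianGroup.lift fun p => fun A => ∫ x in p.2.domain ∩ firstWindow A.1 p.1, p.2.integrand x

/-- `windowEval` on a generator. -/
theorem windowEval_of {n : ℕ} (r : KZ.IntegralRep n) (A : MSet) :
    windowEval (KZ.of r) A = ∫ x in r.domain ∩ firstWindow A.1 n, r.integrand x := by
  simp [windowEval, KZ.of]

/-- `windowEval` at a fixed window is `KZ.restrictedEval` for the window family. -/
theorem windowEval_apply (c : KZ.FormalRep) (A : MSet) :
    windowEval c A = KZ.restrictedEval (firstWindow A.1) c := by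
  induction c using FreeAbelianGroup.induction_on with
  | zero => simp
  | of p =>
    obtain ⟨n, r⟩ := p
    change windowEval (KZ.of r) A = KZ.restrictedEval (firstWindow A.1) (KZ.of r)
    rw [windowEval_of, KZ.restrictedEval_of]
  | neg p hp =>
    obtain ⟨n, r⟩ := p
    change windowEval (-KZ.of r) A = KZ.restrictedEval (firstWindow A.1) (-KZ.of r)
    rw [map_neg, map_neg, Pi.neg_apply, windowEval_of, KZ.restrictedEval_of]
  | add x y hx hy => rw [map_add, map_add, Pi.add_apply, hx, hy]

/-- The additivity moves preserve every first-coordinate window evaluation. -/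
theorem closure_add_le_ker_windowEval :
    AddSubgroup.closure (KZ.domainAddRel ∪ KZ.integrandAddRel) ≤ windowEval.ker := by
  intro c hc
  rw [AddMonoidHom.mem_ker]
  funext A
  rw [windowEval_apply, Pi.zero_apply]
  exact (AddMonoidHom.mem_ker).1
    (KZ.closure_add_le_ker_restrictedEval (firstWindow A.1) (measurableSet_firstWindow A.2) hc)

/-! ## §7.3 The functionals with a semialgebraic primitive, and the quotient invariant -/

/-- The window functionals `A ↦ ∫_{[a,b] ∩ A} g` of densities `g` on a slab `[a, b] ⊂ ℝ¹` that
are derivatives of a `ℚ`-SEMIALGEBRAIC `F` (continuous on `[a,b]`): exactly the first-coordinate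
shadows of the Newton–Leibniz moves from dimension `1` to dimension `0`. -/
def primFunctionals : Set (MSet → ℝ) :=
  {Λ | ∃ (a b : ℝ) (g F : (Fin 1 → ℝ) → ℝ), a ≤ b ∧
    IsSemialgebraicFunOn ℚ {z : Fin 1 → ℝ | z 0 ∈ Icc a b} F ∧
    ContinuousOn (fun t : ℝ => F (fun _ => t)) (Icc a b) ∧
    (∀ t ∈ Ioo a b, HasDerivAt (fun s : ℝ => F (fun _ => s)) (g (fun _ => t)) t) ∧
    IntegrableOn g {z : Fin 1 → ℝ | z 0 ∈ Icc a b} ∧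
    Λ = fun A => ∫ z in {z : Fin 1 → ℝ | z 0 ∈ Icc a b} ∩ {z | z 0 ∈ A.1}, g z}

/-- The subgroup generated by the primitive functionals. -/
def primSpan : AddSubgroup (MSet → ℝ) := AddSubgroup.closure primFunctionals

/-- **The invariant**: first-coordinate window evaluation modulo primitive functionals. -/
def windowClass : KZ.FormalRep →+ (MSet → ℝ) ⧸ primSpan :=
  (QuotientAddGroup.mk' primSpan).comp windowEval

/-- The window class vanishes iff the window evaluation is a combination of primitive functionals. -/
theorem windowClass_eq_zero_iff (c : KZ.FormalRep) : windowClass c = 0 ↔ windowEval c ∈ primSpan := by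
  simp [windowClass]

/-- `Fin.snoc` over the point `ℝ⁰` is the constant function. -/
theorem snoc_fin_zero (x : Fin 0 → ℝ) (t : ℝ) : (Fin.snoc x t : Fin 1 → ℝ) = fun _ => t := by
  funext i
  rw [Fin.fin_one_eq_zero i]
  exact Fin.snoc_last (α := fun _ => ℝ) (p := x) (x := t)

/-- A Newton–Leibniz move from dimension `1` to dimension `0` has window evaluation in
`primFunctionals` (or zero). -/
theorem windowEval_mem_primSpan_of_nl_zero (r : KZ.IntegralRep 1) (r' : KZ.IntegralRep 0)
    (a b : (Fin 0 → ℝ) → ℝ) (F : (Fin 1 → ℝ) → ℝ)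
    (hF : IsSemialgebraicFunOn ℚ r.domain F)
    (hab : ∀ x ∈ r'.domain, a x ≤ b x)
    (hdom : r.domain = {z | (Fin.init z : Fin 0 → ℝ) ∈ r'.domain ∧ a (Fin.init z) ≤ z (Fin.last 0) ∧
      z (Fin.last 0) ≤ b (Fin.init z)})
    (hcont : ∀ x ∈ r'.domain, ContinuousOn (fun t : ℝ => F (Fin.snoc x t)) (Icc (a x) (b x)))
    (hderiv : ∀ x ∈ r'.domain, ∀ t ∈ Ioo (a x) (b x),
      HasDerivAt (fun s : ℝ => F (Fin.snoc x s)) (r.integrand (Fin.snoc x t)) t) :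
    windowEval (KZ.of r - KZ.of r') ∈ primSpan := by
  have h0 : windowEval (KZ.of r') = 0 := by
    funext A; rw [windowEval_of]; simp
  rw [map_sub, h0, sub_zero]
  rcases r'.domain.eq_empty_or_nonempty with hemp | ⟨x₀, hx₀⟩
  · have hd : r.domain = ∅ := by
      rw [hdom]; ext z; simp [hemp]
    have : windowEval (KZ.of r) = 0 := by
      funext A; rw [windowEval_of, hd]; simp
    rw [this]; exact zero_mem _
  · have hd : r.domain = {z : Fin 1 → ℝ | z 0 ∈ Icc (a x₀) (b x₀)} := by
      rw [hdom]; ext z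
      have hi : (Fin.init z : Fin 0 → ℝ) = x₀ := Subsingleton.elim _ _
      simp only [mem_setOf_eq, hi, mem_Icc, Fin.last_zero]
      exact ⟨fun h => h.2, fun h => ⟨hx₀, h⟩⟩
    refine AddSubgroup.subset_closure ⟨a x₀, b x₀, r.integrand, F, hab x₀ hx₀, hd ▸ hF, ?_, ?_,
      hd ▸ r.integrableOn, ?_⟩
    · simpa [snoc_fin_zero] using hcont x₀ hx₀
    · simpa [snoc_fin_zero] using hderiv x₀ hx₀
    · funext A
      rw [windowEval_of, hd]
      rfl

/-- **Rules (1a), (1b), (3) preserve the window class.** -/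
theorem relationsWithoutCoV_le_ker_windowClass : relationsWithoutCoV ≤ windowClass.ker := by
  refine (AddSubgroup.closure_le _).mpr ?_
  rintro c (hc | hc)
  · -- additivity moves: window evaluation itself vanishes
    rw [SetLike.mem_coe, AddMonoidHom.mem_ker, windowClass_eq_zero_iff]
    have : windowEval c = 0 :=
      (AddMonoidHom.mem_ker).1 (closure_add_le_ker_windowEval (AddSubgroup.subset_closure hc))
    rw [this]; exact zero_mem _
  · rw [SetLike.mem_coe, AddMonoidHom.mem_ker, windowClass_eq_zero_iff]
    obtain ⟨n, r, r', a, b, F, hF, -, -, hab, hdom, hcont, hderiv, hr', rfl⟩ := hc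
    cases n with
    | zero => exact windowEval_mem_primSpan_of_nl_zero r r' a b F hF hab hdom hcont hderiv
    | succ m =>
      -- the first coordinate is a base coordinate: the windowed soundness identity
      have : windowEval (KZ.of r - KZ.of r') = 0 := by
        funext A
        rw [map_sub, Pi.sub_apply, Pi.zero_apply, windowEval_of, windowEval_of, sub_eq_zero,
          firstWindow_succ_succ_eq]
        exact setIntegral_band_inter_eq r r' a b F hab hdom hcont hderiv hr'
          (measurableSet_firstWindow A.2 (m + 1))
      rw [this]; exact zero_mem _

/-! ## §7.4 Genus-zero classes live over `(0,1)` on the first axis -/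

/-- A genus-zero representation has zero window evaluation on every window missing `(0,1)`. -/
theorem windowEval_of_eq_zero_of_isGenusZero {k : ℕ} {r : KZ.IntegralRep k} (hr : IsGenusZero r)
    {A : MSet} (hA : Disjoint A.1 (Ioo 0 1)) : windowEval (KZ.of r) A = 0 := by
  obtain ⟨p, a, b, c, hdom, -⟩ := hr
  rw [windowEval_of]
  cases k with
  | zero => simp
  | succ m =>
    have : r.domain ∩ firstWindow A.1 (m + 1) = ∅ := by
      rw [hdom, firstWindow_succ]
      ext x
      simp only [simplex, mem_inter_iff, mem_setOf_eq, mem_empty_iff_false, iff_false, not_and]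
      intro hx hA0
      exact hA.le_bot ⟨hA0, hx.1 0, hx.2.1 0⟩
    rw [this]; simp

/-- Hence so does every element of the genus-zero closure. -/
theorem windowEval_eq_zero_of_mem_closure {c₀ : KZ.FormalRep}
    (h : c₀ ∈ AddSubgroup.closure {x | ∃ (k : ℕ) (r : KZ.IntegralRep k), IsGenusZero r ∧ x = KZ.of r})
    {A : MSet} (hA : Disjoint A.1 (Ioo 0 1)) : windowEval c₀ A = 0 := by
  induction h using AddSubgroup.closure_induction with
  | mem x hx =>
    obtain ⟨k, r, hr, rfl⟩ := hx
    exact windowEval_of_eq_zero_of_isGenusZero hr hA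
  | zero => simp
  | add x y _ _ hx hy => simp [hx, hy]
  | neg x _ hx => simp [hx]

/-! ## §7.5 Elements of `primSpan` have local semialgebraic primitives off finitely many points -/

/-- The rational slab `{z | z₀ ∈ [α, β]} ⊂ ℝ¹` is `ℚ`-semialgebraic. -/
theorem isSemialgebraic_slab (α β : ℚ) :
    Literature.ModelTheory.ExponentialFields.IsSemialgebraic ℚ {z : Fin 1 → ℝ | z 0 ∈ Icc (α : ℝ) β} := by
  have h1 : Literature.ModelTheory.ExponentialFields.IsSemialgebraic ℚ
      {z : Fin 1 → ℝ | 0 < MvPolynomial.aeval z (MvPolynomial.X 0 - MvPolynomial.C α : MvPolynomial (Fin 1) ℚ)} :=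
    Literature.ModelTheory.ExponentialFields.isSemialgebraic_setOf_eval_pos (k := ℚ) _
  have h2 : Literature.ModelTheory.ExponentialFields.IsSemialgebraic ℚ
      {z : Fin 1 → ℝ | 0 < MvPolynomial.aeval z (MvPolynomial.C β - MvPolynomial.X 0 : MvPolynomial (Fin 1) ℚ)} :=
    Literature.ModelTheory.ExponentialFields.isSemialgebraic_setOf_eval_pos (k := ℚ) _
  have h1' : Literature.ModelTheory.ExponentialFields.IsSemialgebraic ℚ
      {z : Fin 1 → ℝ | MvPolynomial.aeval z (MvPolynomial.X 0 - MvPolynomial.C α : MvPolynomial (Fin 1) ℚ) = 0} :=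
    Literature.ModelTheory.ExponentialFields.isSemialgebraic_setOf_eval_eq_zero (k := ℚ) _
  have h2' : Literature.ModelTheory.ExponentialFields.IsSemialgebraic ℚ
      {z : Fin 1 → ℝ | MvPolynomial.aeval z (MvPolynomial.C β - MvPolynomial.X 0 : MvPolynomial (Fin 1) ℚ) = 0} :=
    Literature.ModelTheory.ExponentialFields.isSemialgebraic_setOf_eval_eq_zero (k := ℚ) _
  convert (h2.union h2').inter (h1.union h1') using 1
  ext z
  simp only [mem_setOf_eq, mem_Icc, mem_inter_iff, mem_union, map_sub, MvPolynomial.aeval_C,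
    MvPolynomial.aeval_X, eq_ratCast, sub_pos, sub_eq_zero]
  constructor
  · rintro ⟨ha, hb⟩
    exact ⟨hb.lt_or_eq.imp id Eq.symm, ha.lt_or_eq.imp id Eq.symm⟩
  · rintro ⟨hb, ha⟩
    exact ⟨ha.elim le_of_lt ge_of_eq, hb.elim le_of_lt ge_of_eq⟩

/-- Local primitive data for a window functional on the rational slab `[α, β]`: a `ℚ`-semialgebraic
`F` with derivative `g` inside, `g` integrable, and `Λ(A) = ∫_{z₀ ∈ A} g` for measurable `A ⊆ [α, β]`. -/
def HasLocalPrimitive (Λ : MSet → ℝ) (α β : ℚ) : Prop :=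
  ∃ (g F : (Fin 1 → ℝ) → ℝ), IsSemialgebraicFunOn ℚ {z : Fin 1 → ℝ | z 0 ∈ Icc (α : ℝ) β} F ∧
    (∀ t ∈ Ioo (α : ℝ) β, HasDerivAt (fun s : ℝ => F (fun _ => s)) (g (fun _ => t)) t) ∧
    IntegrableOn g {z : Fin 1 → ℝ | z 0 ∈ Icc (α : ℝ) β} ∧
    ∀ A : MSet, A.1 ⊆ Icc (α : ℝ) β → Λ A = ∫ z in {z : Fin 1 → ℝ | z 0 ∈ A.1}, g z

/-- Off a finite set of "endpoints", `Λ` has local primitives on every rational closed interval. -/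
def LocallyPrimitive (Λ : MSet → ℝ) : Prop :=
  ∃ E : Finset ℝ, ∀ α β : ℚ, (α : ℝ) < β → Disjoint (Icc (α : ℝ) β) (E : Set ℝ) → HasLocalPrimitive Λ α β

/-- A functional vanishing on the subsets of `[α, β]` has local primitives there (`g = F = 0`). -/
theorem hasLocalPrimitive_zero (α β : ℚ) {Λ : MSet → ℝ}
    (hΛ : ∀ A : MSet, A.1 ⊆ Icc (α : ℝ) β → Λ A = 0) : HasLocalPrimitive Λ α β := by
  refine ⟨0, 0, (isSemialgebraicFunOn_aeval (isSemialgebraic_slab α β) 0).congr fun x _ => by simp,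
    fun t _ => by simpa using hasDerivAt_const t (0 : ℝ), integrableOn_zero, fun A hA => ?_⟩
  rw [hΛ A hA]
  simp

/-- Local primitives add. -/
theorem HasLocalPrimitive.add {Λ₁ Λ₂ : MSet → ℝ} {α β : ℚ} (h₁ : HasLocalPrimitive Λ₁ α β)
    (h₂ : HasLocalPrimitive Λ₂ α β) : HasLocalPrimitive (Λ₁ + Λ₂) α β := by
  obtain ⟨g₁, F₁, hF₁, hd₁, hi₁, hΛ₁⟩ := h₁
  obtain ⟨g₂, F₂, hF₂, hd₂, hi₂, hΛ₂⟩ := h₂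
  refine ⟨g₁ + g₂, F₁ + F₂, IsSemialgebraicFunOn.add_holds hF₁ hF₂,
    fun t ht => (hd₁ t ht).add (hd₂ t ht), hi₁.add hi₂, fun A hA => ?_⟩
  have hsub : {z : Fin 1 → ℝ | z 0 ∈ A.1} ⊆ {z : Fin 1 → ℝ | z 0 ∈ Icc (α : ℝ) β} := fun z hz => hA hz
  rw [Pi.add_apply, hΛ₁ A hA, hΛ₂ A hA, ← integral_add (hi₁.mono_set hsub) (hi₂.mono_set hsub)]
  rfl

/-- Local primitives negate. -/
theorem HasLocalPrimitive.neg {Λ : MSet → ℝ} {α β : ℚ} (h : HasLocalPrimitive Λ α β) :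
    HasLocalPrimitive (-Λ) α β := by
  obtain ⟨g, F, hF, hd, hi, hΛ⟩ := h
  refine ⟨-g, -F, hF.neg, fun t ht => (hd t ht).neg, hi.neg, fun A hA => ?_⟩
  rw [Pi.neg_apply, hΛ A hA, ← integral_neg]
  rfl

/-- A primitive functional has local primitives off its two endpoints. -/
theorem locallyPrimitive_of_mem_primFunctionals {Λ : MSet → ℝ} (h : Λ ∈ primFunctionals) :
    LocallyPrimitive Λ := by
  obtain ⟨a, b, g, F, hab, hF, -, hd, hi, rfl⟩ := h
  refine ⟨{a, b}, fun α β hαβ hdisj => ?_⟩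
  have ha : a ∉ Icc (α : ℝ) β := fun h => hdisj.le_bot ⟨h, by simp⟩
  have hb : b ∉ Icc (α : ℝ) β := fun h => hdisj.le_bot ⟨h, by simp⟩
  simp only [mem_Icc, not_and, not_le] at ha hb
  by_cases hcase : a < α ∧ (β : ℝ) < b
  · -- the interval lies inside `(a, b)`: restrict the data
    have hsub : {z : Fin 1 → ℝ | z 0 ∈ Icc (α : ℝ) β} ⊆ {z : Fin 1 → ℝ | z 0 ∈ Icc a b} :=
      fun z hz => ⟨hcase.1.le.trans hz.1, hz.2.trans hcase.2.le⟩
    refine ⟨g, F, hF.mono hsub (isSemialgebraic_slab α β),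
      fun t ht => hd t ⟨hcase.1.trans ht.1, ht.2.trans hcase.2⟩, hi.mono_set hsub, fun A hA => ?_⟩
    have : {z : Fin 1 → ℝ | z 0 ∈ Icc a b} ∩ {z | z 0 ∈ A.1} = {z : Fin 1 → ℝ | z 0 ∈ A.1} := by
      ext z
      simp only [mem_inter_iff, mem_setOf_eq, and_iff_right_iff_imp]
      exact fun hz => hsub (hA hz)
    simp only [this]
  · -- the interval misses `[a, b]`: the functional vanishes on its subsets
    refine hasLocalPrimitive_zero α β fun A hA => ?_
    have hempty : {z : Fin 1 → ℝ | z 0 ∈ Icc a b} ∩ {z | z 0 ∈ A.1} = ∅ := by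
      ext z
      simp only [mem_inter_iff, mem_setOf_eq, mem_Icc, mem_empty_iff_false, iff_false, not_and]
      intro hz hzA
      have hzI := hA hzA
      rw [not_and_or] at hcase
      rcases hcase with h | h
      · have : (β : ℝ) < a := ha (not_lt.1 h)
        linarith [hz.1, hzI.2]
      · have hb' : (β : ℝ) < b ∨ b < α := by
          by_cases h' : (α : ℝ) ≤ b
          · exact Or.inl (hb h')
          · exact Or.inr (not_le.1 h')
        rcases hb' with h' | h'
        · exact h h'
        · linarith [hz.2, hzI.1]
    simp only [hempty, Measure.restrict_empty, integral_zero_measure]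

/-- **Every element of `primSpan` is locally primitive.** -/
theorem locallyPrimitive_of_mem_primSpan {Λ : MSet → ℝ} (h : Λ ∈ primSpan) : LocallyPrimitive Λ := by
  induction h using AddSubgroup.closure_induction with
  | mem x hx => exact locallyPrimitive_of_mem_primFunctionals hx
  | zero => exact ⟨∅, fun α β _ _ => hasLocalPrimitive_zero α β fun A _ => rfl⟩
  | add x y _ _ hx hy =>
    obtain ⟨E₁, h₁⟩ := hx
    obtain ⟨E₂, h₂⟩ := hy
    refine ⟨E₁ ∪ E₂, fun α β hαβ hdisj => ?_⟩
    rw [Finset.coe_union, disjoint_union_right] at hdisj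
    exact (h₁ α β hαβ hdisj.1).add (h₂ α β hαβ hdisj.2)
  | neg x _ hx =>
    obtain ⟨E, hE⟩ := hx
    exact ⟨E, fun α β hαβ hdisj => (hE α β hαβ hdisj).neg⟩

/-! ## §7.6 The witness pair `∫₃⁴ dt/(t − 5)` and `∫₀¹ dt/(t − 2)` (translates; both `−log 2`) -/

/-- The rational slab as a product of intervals (for compactness). -/
theorem slab_eq_pi (a b : ℝ) :
    {z : Fin 1 → ℝ | z 0 ∈ Icc a b} = Set.pi univ fun _ => Icc a b := by
  ext z
  simp only [mem_setOf_eq, mem_pi, mem_univ, forall_const, Fin.forall_fin_one]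

/-- Transport of slab integrals to the line. -/
theorem setIntegral_slab_eq (f : ℝ → ℝ) {B : Set ℝ} (_hB : MeasurableSet B) :
    ∫ z in {z : Fin 1 → ℝ | z 0 ∈ B}, f (z 0) = ∫ t in B, f t := by
  have h := (volume_preserving_funUnique (Fin 1) ℝ).setIntegral_preimage_emb
    (MeasurableEquiv.funUnique (Fin 1) ℝ).measurableEmbedding f B
  rw [MeasurableEquiv.funUnique_apply] at h
  exact h

/-- The representation `[[a, b], 1/(t − p)]` for rationals `a ≤ b` and a rational pole
`p ∉ [a, b]` (KZ-literal data `1 / (X₀ − p)` on the slab `{z | z₀ ∈ [a, b]} ⊂ ℝ¹`). -/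
def invRep (a b p : ℚ) (hp : (p : ℝ) ∉ Icc (a : ℝ) b) : KZ.IntegralRep 1 :=
  KZ.IntegralRep.ofRational {z : Fin 1 → ℝ | z 0 ∈ Icc (a : ℝ) b} 1
    (MvPolynomial.X 0 - MvPolynomial.C p) (isSemialgebraic_slab a b)
    (fun z hz => by
      simp only [map_sub, MvPolynomial.aeval_X, MvPolynomial.aeval_C, eq_ratCast, ne_eq, sub_eq_zero]
      intro h
      exact hp (h ▸ hz))
    (by
      have hK : IsCompact {z : Fin 1 → ℝ | z 0 ∈ Icc (a : ℝ) b} := by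
        rw [slab_eq_pi]; exact isCompact_univ_pi fun _ => isCompact_Icc
      refine ContinuousOn.integrableOn_compact hK ?_
      have hfun : (fun x : Fin 1 → ℝ => MvPolynomial.aeval x (1 : MvPolynomial (Fin 1) ℚ) /
          MvPolynomial.aeval x (MvPolynomial.X 0 - MvPolynomial.C p : MvPolynomial (Fin 1) ℚ)) =
          fun z : Fin 1 → ℝ => 1 / (z 0 - (p : ℝ)) := by
        funext z; simp
      rw [hfun]
      refine ContinuousOn.div continuousOn_const
        (((continuous_apply 0).continuousOn).sub continuousOn_const) fun z hz => ?_
      rw [sub_ne_zero]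
      intro h
      exact hp (h ▸ hz))

/-- The domain of `[[a,b], 1/(t − p)]`. -/
theorem invRep_domain (a b p : ℚ) (hp : (p : ℝ) ∉ Icc (a : ℝ) b) :
    (invRep a b p hp).domain = {z : Fin 1 → ℝ | z 0 ∈ Icc (a : ℝ) b} := rfl

/-- The integrand of `[[a,b], 1/(t − p)]`. -/
theorem invRep_integrand (a b p : ℚ) (hp : (p : ℝ) ∉ Icc (a : ℝ) b) (z : Fin 1 → ℝ) :
    (invRep a b p hp).integrand z = 1 / (z 0 - p) := by
  simp [invRep]

/-- `value [[a,b], 1/(t − p)] = ∫_{a−p}^{b−p} dx/x`. -/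
theorem invRep_value (a b p : ℚ) (hp : (p : ℝ) ∉ Icc (a : ℝ) b) (hab : (a : ℝ) ≤ b) :
    (invRep a b p hp).value = ∫ x in ((a : ℝ) - p)..((b : ℝ) - p), 1 / x := by
  rw [KZ.IntegralRep.value, invRep_domain]
  have h1 : (fun z => (invRep a b p hp).integrand z) = fun z : Fin 1 → ℝ => (fun t : ℝ => 1 / (t - p)) (z 0) :=
    funext fun z => invRep_integrand a b p hp z
  rw [h1, setIntegral_slab_eq (fun t : ℝ => 1 / (t - p)) measurableSet_Icc,
    integral_Icc_eq_integral_Ioc, ← intervalIntegral.integral_of_le hab,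
    ← intervalIntegral.integral_comp_sub_right (fun x : ℝ => 1 / x) (p : ℝ)]

/-- `5 ∉ [3, 4]`. -/
theorem five_notMem : ((5 : ℚ) : ℝ) ∉ Icc ((3 : ℚ) : ℝ) ((4 : ℚ) : ℝ) := by norm_num
/-- `2 ∉ [0, 1]`. -/
theorem two_notMem : ((2 : ℚ) : ℝ) ∉ Icc ((0 : ℚ) : ℝ) ((1 : ℚ) : ℝ) := by norm_num

/-- `W₁ = [[3,4], 1/(t−5)]`. -/
def repW₁ : KZ.IntegralRep 1 := invRep 3 4 5 five_notMem
/-- `W₂ = [[0,1], 1/(t−2)]`, the translate of `W₁` by `−3`. -/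
def repW₂ : KZ.IntegralRep 1 := invRep 0 1 2 two_notMem

/-- The two translates have the same value (`∫_{−2}^{−1} dx/x = −log 2`), so `[W₁] − [W₂] ∈ ker eval`
(in the full calculus it is ONE change of variables `t ↦ t − 3`). -/
theorem eval_sub_eq_zero : KZ.eval (KZ.of repW₁ - KZ.of repW₂) = 0 := by
  rw [map_sub, KZ.eval_of, KZ.eval_of, repW₁, repW₂, invRep_value _ _ _ _ (by norm_num),
    invRep_value _ _ _ _ (by norm_num)]
  norm_num

/-- **The witness is ONE move in the full calculus**: `[W₁] − [W₂]` is the change of variables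
`z ↦ z − 3` (rule (2)). So §7.7 isolates rule (2) exactly. -/
theorem of_repW₁_sub_of_repW₂_mem_changeOfVariablesRel :
    KZ.of repW₁ - KZ.of repW₂ ∈ KZ.changeOfVariablesRel := by
  refine ⟨1, repW₁, repW₂, fun z => z - fun _ => (3 : ℝ), fun _ => ContinuousLinearMap.id ℝ (Fin 1 → ℝ),
    ?_, ?_, ?_, ?_, ?_, rfl⟩
  · refine (isSemialgebraicMapOn_aeval repW₁.isSemialgebraic_domain
      (fun _ => MvPolynomial.X 0 - MvPolynomial.C 3 : Fin 1 → MvPolynomial (Fin 1) ℚ)).congr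
      fun z _ => ?_
    funext j
    rw [Fin.fin_one_eq_zero j]
    simp
  · intro z _
    exact ((hasFDerivAt_id z).sub_const (fun _ : Fin 1 => (3 : ℝ))).hasFDerivWithinAt
  · intro z _ w _ h
    exact sub_left_injective h
  · ext w
    simp only [repW₁, repW₂, invRep_domain, mem_image, mem_setOf_eq, mem_Icc]
    push_cast
    constructor
    · intro hw
      refine ⟨fun _ => w 0 + 3, ⟨by linarith [hw.1], by linarith [hw.2]⟩, ?_⟩
      funext j
      rw [Fin.fin_one_eq_zero j, Pi.sub_apply]
      ring
    · rintro ⟨z, hz, rfl⟩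
      rw [Pi.sub_apply]
      constructor <;> linarith [hz.1, hz.2]
  · intro z _
    rw [repW₁, repW₂, invRep_integrand, invRep_integrand]
    simp only [Pi.sub_apply, ContinuousLinearMap.det, ContinuousLinearMap.coe_id, LinearMap.det_id,
      abs_one, mul_one]
    push_cast
    ring

/-- Hence `[W₁] − [W₂] ∈ KZ.relations` (the value equality is one rule-(2) move). -/
theorem of_repW₁_sub_of_repW₂_mem_relations : KZ.of repW₁ - KZ.of repW₂ ∈ KZ.relations :=
  KZ.changeOfVariablesRel_subset_relations of_repW₁_sub_of_repW₂_mem_changeOfVariablesRel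

/-! ## §7.7 The endgame: no change of variables ⇒ a semialgebraic primitive of `1/(t − 5)` -/

/-- Inside `(3,4)` there is a rational closed interval missing any given finite set. -/
theorem exists_rat_Icc_disjoint (E : Finset ℝ) :
    ∃ α β : ℚ, (α : ℝ) < β ∧ (3 : ℝ) < α ∧ (β : ℝ) < 4 ∧ Disjoint (Icc (α : ℝ) β) (E : Set ℝ) := by
  obtain ⟨t, ht, htE⟩ := (Set.Ioo_infinite (by norm_num : (3 : ℝ) < 4)).exists_notMem_finset E
  have hopen : IsOpen (Ioo (3 : ℝ) 4 \ (E : Set ℝ)) := isOpen_Ioo.sdiff E.finite_toSet.isClosed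
  obtain ⟨ε, hε, hball⟩ := Metric.isOpen_iff.1 hopen t ⟨ht, htE⟩
  obtain ⟨α, hα₁, hα₂⟩ := exists_rat_btwn (show t - ε / 2 < t by linarith)
  obtain ⟨β, hβ₁, hβ₂⟩ := exists_rat_btwn (show t < t + ε / 2 by linarith)
  have hsub : Icc (α : ℝ) β ⊆ Ioo (3 : ℝ) 4 \ (E : Set ℝ) := fun x hx => hball (by
    rw [Metric.mem_ball, Real.dist_eq, abs_lt]
    constructor <;> linarith [hx.1, hx.2])
  refine ⟨α, β, by exact_mod_cast hα₂.trans hβ₁, (hsub ⟨le_rfl, ?_⟩).1.1, (hsub ⟨?_, le_rfl⟩).1.2,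
    Set.disjoint_left.2 fun x hx hxE => (hsub hx).2 hxE⟩
  · exact_mod_cast (hα₂.trans hβ₁).le
  · exact_mod_cast (hα₂.trans hβ₁).le

/-- Two functions continuous on an open interval that agree off a null set agree everywhere. -/
theorem eqOn_of_continuousOn_of_null {u v : ℝ → ℝ} {a b : ℝ}
    (hu : ContinuousOn u (Ioo a b)) (hv : ContinuousOn v (Ioo a b))
    (h0 : volume {t | t ∈ Ioo a b ∧ u t ≠ v t} = 0) : EqOn u v (Ioo a b) := by
  intro t₀ ht₀
  by_contra hne
  have hcont : ContinuousAt (fun t => u t - v t) t₀ :=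
    ((hu.sub hv).continuousWithinAt ht₀).continuousAt (isOpen_Ioo.mem_nhds ht₀)
  have hev : ∀ᶠ t in nhds t₀, u t - v t ≠ 0 ∧ t ∈ Ioo a b :=
    (hcont.eventually_ne (sub_ne_zero.2 hne)).and (isOpen_Ioo.mem_nhds ht₀)
  obtain ⟨δ, hδ, hδsub⟩ := Metric.eventually_nhds_iff_ball.1 hev
  have hsub : Metric.ball t₀ δ ⊆ {t | t ∈ Ioo a b ∧ u t ≠ v t} := fun t ht =>
    ⟨(hδsub t ht).2, sub_ne_zero.1 (hδsub t ht).1⟩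
  have hball0 : volume (Metric.ball t₀ δ) = 0 := measure_mono_null hsub h0
  rw [Real.volume_ball] at hball0
  exact (ENNReal.ofReal_pos.2 (by linarith : (0 : ℝ) < 2 * δ)).ne' hball0

/-- The genus-zero generator set (as in the companion file). -/
def gzGens : Set KZ.FormalRep := {x | ∃ (k : ℕ) (r : KZ.IntegralRep k), IsGenusZero r ∧ x = KZ.of r}

/-- **The crux WITHOUT rule (2)**: `KZ.relations` replaced by the sub-calculus (1a)+(1b)+(3). -/
def ResidualWithoutChangeOfVariables : Prop :=
  ∀ c : KZ.FormalRep, KZ.eval c = 0 →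
    ∃ c₀ ∈ AddSubgroup.closure gzGens, c - c₀ ∈ relationsWithoutCoV

/-- **Rule (2) is load-bearing for the residual.** The vanishing combination `[W₁] − [W₂]`
(`∫₃⁴ dt/(t−5)` minus its translate `∫₀¹ dt/(t−2)`, one change of variables in the full calculus)
has NO genus-zero normal form in the sub-calculus generated by the additivity and Newton–Leibniz
moves: the first-coordinate window class `windowClass` kills that sub-calculus, the genus-zero
closure has zero window evaluation off `(0,1)`, so a normal form would make the window functional
`A ↦ ∫_{A ∩ [3,4]} dt/(t − 5)` locally primitive — i.e. give `1/(t − 5)` a `ℚ`-semialgebraic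
primitive on some rational interval, which after an affine rescaling contradicts the barrier
`Literature/Barriers/KontsevichZagierPeriods/AlgebraicPrimitivesObstruction` (no function algebraic
over `ℝ(t)` has a derivative with a non-zero residue). -/
theorem residual_false_without_changeOfVariables : ¬ ResidualWithoutChangeOfVariables := by
  intro h
  obtain ⟨c₀, hc₀, hrel⟩ := h _ eval_sub_eq_zero
  -- (1) the invariant: the window functional of `[W₁] − [W₂] − c₀` is in `primSpan`
  have hcl : windowEval (KZ.of repW₁ - KZ.of repW₂ - c₀) ∈ primSpan :=
    (windowClass_eq_zero_iff _).1
      ((AddMonoidHom.mem_ker).1 (relationsWithoutCoV_le_ker_windowClass hrel))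
  obtain ⟨E, hE⟩ := locallyPrimitive_of_mem_primSpan hcl
  -- (2) a rational interval `[α, β] ⊂ (3,4)` missing the endpoints `E`
  obtain ⟨α, β, hαβ, h3α, hβ4, hdisj⟩ := exists_rat_Icc_disjoint E
  obtain ⟨g, F, hF, hd, hi, hΛ⟩ := hE α β hαβ hdisj
  -- (3) on subsets of `[α, β]` the window functional is `A ↦ ∫_{z₀ ∈ A} 1/(z₀ − 5)`
  have hW : ∀ A : MSet, A.1 ⊆ Icc (α : ℝ) β →
      windowEval (KZ.of repW₁ - KZ.of repW₂ - c₀) A =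
        ∫ z in {z : Fin 1 → ℝ | z 0 ∈ A.1}, (1 / (z 0 - 5) : ℝ) := by
    intro A hA
    have hA34 : A.1 ⊆ Icc (3 : ℝ) 4 := fun t ht => ⟨(h3α.trans_le (hA ht).1).le, ((hA ht).2.trans_lt hβ4).le⟩
    have hdisj01 : Disjoint A.1 (Ioo (0 : ℝ) 1) :=
      Set.disjoint_left.2 fun t ht ht' => by linarith [(hA34 ht).1, ht'.2]
    rw [map_sub, map_sub, Pi.sub_apply, Pi.sub_apply, windowEval_eq_zero_of_mem_closure hc₀ hdisj01,
      sub_zero, windowEval_of, windowEval_of]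
    have h1 : repW₁.domain ∩ firstWindow A.1 1 = {z : Fin 1 → ℝ | z 0 ∈ A.1} := by
      rw [repW₁, invRep_domain, firstWindow_succ]
      ext z
      simp only [mem_inter_iff, mem_setOf_eq, and_iff_right_iff_imp]
      intro hz
      exact_mod_cast hA34 hz
    have h2 : repW₂.domain ∩ firstWindow A.1 1 = ∅ := by
      rw [repW₂, invRep_domain, firstWindow_succ]
      ext z
      simp only [mem_inter_iff, mem_setOf_eq, mem_empty_iff_false, iff_false, not_and]
      intro hz hzA
      have := (hA34 hzA).1
      have := hz.2
      push_cast at this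
      linarith
    rw [h1, h2, Measure.restrict_empty, integral_zero_measure, sub_zero]
    refine setIntegral_congr_fun (measurable_pi_apply 0 A.2) fun z _ => ?_
    rw [repW₁, invRep_integrand]
    push_cast
    ring
  -- (4) hence `g = 1/(z₀ − 5)` a.e. on the slab over `[α, β]`
  set slab : Set (Fin 1 → ℝ) := {z | z 0 ∈ Icc (α : ℝ) β} with hslab
  have hslabm : MeasurableSet slab := measurable_pi_apply 0 measurableSet_Icc
  have hwi : IntegrableOn (fun z : Fin 1 → ℝ => (1 / (z 0 - 5) : ℝ)) slab := by
    have hK : IsCompact slab := by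
      rw [hslab, slab_eq_pi]; exact isCompact_univ_pi fun _ => isCompact_Icc
    refine ContinuousOn.integrableOn_compact hK (ContinuousOn.div continuousOn_const
      (((continuous_apply 0).continuousOn).sub continuousOn_const) fun z hz h0 => ?_)
    linarith [hz.2, sub_eq_zero.1 h0]
  have hae : (fun z : Fin 1 → ℝ => (1 / (z 0 - 5) : ℝ)) =ᵐ[volume.restrict slab] g := by
    refine Integrable.ae_eq_of_forall_setIntegral_eq _ _ hwi hi fun s hs _ => ?_
    -- `s ∩ slab` is a first-coordinate set `{z | z 0 ∈ A}` with `A ⊆ [α, β]` measurable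
    set A : Set ℝ := {t | t ∈ Icc (α : ℝ) β ∧ (fun _ : Fin 1 => t) ∈ s} with hAdef
    have hAm : MeasurableSet A :=
      measurableSet_Icc.inter ((measurable_pi_lambda _ fun _ => measurable_id) hs)
    have hAsub : A ⊆ Icc (α : ℝ) β := fun t ht => ht.1
    have hsA : s ∩ slab = {z : Fin 1 → ℝ | z 0 ∈ A} := by
      ext z
      have hz : (fun _ : Fin 1 => z 0) = z := by funext i; rw [Fin.fin_one_eq_zero i]
      simp only [mem_inter_iff, hslab, mem_setOf_eq, hAdef, hz]
      tauto
    rw [Measure.restrict_restrict hs, hsA, ← hW ⟨A, hAm⟩ hAsub, hΛ ⟨A, hAm⟩ hAsub]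
  -- (5) the smooth locus of `F` inside the open slab: an open sub-interval `V`
  set U : Set (Fin 1 → ℝ) := {z | z 0 ∈ Ioo (α : ℝ) β} with hU
  have hUo : IsOpen U := isOpen_Ioo.preimage (continuous_apply 0)
  have hUsa : Literature.ModelTheory.ExponentialFields.IsSemialgebraic ℚ U := by
    have h1 := Literature.ModelTheory.ExponentialFields.isSemialgebraic_setOf_eval_pos (k := ℚ) (R := ℝ)
      (MvPolynomial.X 0 - MvPolynomial.C α : MvPolynomial (Fin 1) ℚ)
    have h2 := Literature.ModelTheory.ExponentialFields.isSemialgebraic_setOf_eval_pos (k := ℚ) (R := ℝ)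
      (MvPolynomial.C β - MvPolynomial.X 0 : MvPolynomial (Fin 1) ℚ)
    convert h1.inter h2 using 1
    ext z
    simp [hU, sub_pos]
  have hFU : IsSemialgebraicFunOn ℚ U F := hF.mono (fun z hz => Ioo_subset_Icc_self hz) hUsa
  obtain ⟨Z, hZU, -, hZint, hUZo, hsmooth⟩ := IsSemialgebraicFunOn.exists_contDiffOn_holds hUo hFU
  have hne : (U \ Z).Nonempty := by
    by_contra hempty
    rw [Set.not_nonempty_iff_eq_empty, Set.sdiff_eq_empty] at hempty
    have hmid : (fun _ : Fin 1 => ((α : ℝ) + β) / 2) ∈ interior Z := by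
      apply interior_mono hempty
      rw [hUo.interior_eq]
      show ((α : ℝ) + β) / 2 ∈ Ioo (α : ℝ) β
      constructor <;> linarith
    rw [hZint] at hmid
    exact hmid
  obtain ⟨z₁, hz₁⟩ := hne
  obtain ⟨ε, hε, hballsub⟩ := Metric.isOpen_iff.1 hUZo z₁ hz₁
  set t₁ : ℝ := z₁ 0 with ht₁
  have hz₁eq : z₁ = fun _ => t₁ := by funext i; rw [Fin.fin_one_eq_zero i]
  have hconst_mem : ∀ t ∈ Ioo (t₁ - ε) (t₁ + ε), (fun _ : Fin 1 => t) ∈ U \ Z := by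
    intro t ht
    apply hballsub
    rw [Metric.mem_ball, hz₁eq, dist_pi_lt_iff hε]
    intro i
    rw [Real.dist_eq, abs_lt]
    constructor <;> linarith [ht.1, ht.2]
  have hVU : ∀ t ∈ Ioo (t₁ - ε) (t₁ + ε), t ∈ Ioo (α : ℝ) β := fun t ht => (hconst_mem t ht).1
  -- (6) on `V`, `t ↦ F (const t)` is smooth, so its derivative `t ↦ g (const t)` is continuous
  set φ : ℝ → ℝ := fun t => F (fun _ => t) with hφ
  have hφs : ContDiffOn ℝ ((⊤ : ℕ∞) : WithTop ℕ∞) φ (Ioo (t₁ - ε) (t₁ + ε)) := by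
    have hc : ContDiffOn ℝ ((⊤ : ℕ∞) : WithTop ℕ∞) (fun t : ℝ => (fun _ : Fin 1 => t))
        (Ioo (t₁ - ε) (t₁ + ε)) :=
      (contDiff_pi.2 fun _ => contDiff_id).contDiffOn
    exact hsmooth.comp hc fun t ht => hconst_mem t ht
  have hderφ : ∀ t ∈ Ioo (t₁ - ε) (t₁ + ε), deriv φ t = g (fun _ => t) :=
    fun t ht => (hd t (hVU t ht)).deriv
  have hgc : ContinuousOn (fun t : ℝ => g (fun _ => t)) (Ioo (t₁ - ε) (t₁ + ε)) :=
    (hφs.continuousOn_deriv_of_isOpen isOpen_Ioo (by simp)).congr fun t ht => (hderφ t ht).symm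
  have hwc : ContinuousOn (fun t : ℝ => (1 / (t - 5) : ℝ)) (Ioo (t₁ - ε) (t₁ + ε)) := by
    refine ContinuousOn.div continuousOn_const (continuousOn_id.sub continuousOn_const) fun t ht h0 => ?_
    linarith [(hVU t ht).2, sub_eq_zero.1 h0]
  -- (7) `g (const t) = 1/(t − 5)` a.e. on `[α, β]` (transport of (4) to the line), hence on all of `V`
  have hnull : volume {t : ℝ | t ∈ Ioo (t₁ - ε) (t₁ + ε) ∧ (1 / (t - 5) : ℝ) ≠ g (fun _ => t)} = 0 := by
    have h0 : volume ({z : Fin 1 → ℝ | (1 / (z 0 - 5) : ℝ) ≠ g z} ∩ slab) = 0 := by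
      have := ae_iff.1 hae
      rwa [Measure.restrict_apply' hslabm] at this
    set e := MeasurableEquiv.funUnique (Fin 1) ℝ with he
    have hmp : MeasurePreserving e volume volume := volume_preserving_funUnique (Fin 1) ℝ
    have hpre : e ⁻¹' {t : ℝ | t ∈ Icc (α : ℝ) β ∧ (1 / (t - 5) : ℝ) ≠ g (fun _ => t)} =
        {z : Fin 1 → ℝ | (1 / (z 0 - 5) : ℝ) ≠ g z} ∩ slab := by
      ext z
      have hz : (fun _ : Fin 1 => z 0) = z := by funext i; rw [Fin.fin_one_eq_zero i]
      simp only [he, MeasurableEquiv.funUnique_apply, mem_preimage, mem_setOf_eq, mem_inter_iff, hslab]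
      rw [show (default : Fin 1) = 0 from rfl, hz]
      tauto
    have h1 : volume {t : ℝ | t ∈ Icc (α : ℝ) β ∧ (1 / (t - 5) : ℝ) ≠ g (fun _ => t)} = 0 := by
      rw [← hmp.map_eq, MeasurableEquiv.map_apply, hpre, h0]
    refine measure_mono_null ?_ h1
    intro t ht
    exact ⟨Ioo_subset_Icc_self (hVU t ht.1), ht.2⟩
  have heq : EqOn (fun t : ℝ => (1 / (t - 5) : ℝ)) (fun t => g (fun _ => t)) (Ioo (t₁ - ε) (t₁ + ε)) :=
    eqOn_of_continuousOn_of_null hwc hgc hnull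
  have hderiv5 : ∀ t ∈ Ioo (t₁ - ε) (t₁ + ε), HasDerivAt φ (1 / (t - 5)) t := fun t ht =>
    (hd t (hVU t ht)).congr_deriv (heq ht).symm
  -- (8) a rational closed sub-interval `[α₂, β₂] ⊂ V` and the affine rescaling to `[0, 1]`
  obtain ⟨α₂, hα₂l, hα₂r⟩ := exists_rat_btwn (show t₁ - ε < t₁ by linarith)
  obtain ⟨β₂, hβ₂l, hβ₂r⟩ := exists_rat_btwn (show t₁ < t₁ + ε by linarith)
  have hαβ₂ : (α₂ : ℝ) < β₂ := hα₂r.trans hβ₂l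
  set lam : ℚ := β₂ - α₂ with hlam
  have hlam0 : (0 : ℝ) < lam := by rw [hlam]; push_cast; linarith
  set Φ : (Fin 1 → ℝ) → (Fin 1 → ℝ) := fun x _ => (α₂ : ℝ) + (lam : ℝ) * x 0 with hΦ
  have h01sa : Literature.ModelTheory.ExponentialFields.IsSemialgebraic ℚ {x : Fin 1 → ℝ | x 0 ∈ Icc (0 : ℝ) 1} := by
    simpa using isSemialgebraic_slab 0 1
  have hΦsa : IsSemialgebraicMapOn ℚ {x : Fin 1 → ℝ | x 0 ∈ Icc (0 : ℝ) 1} Φ := by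
    refine (isSemialgebraicMapOn_aeval h01sa
      (fun _ => MvPolynomial.C α₂ + MvPolynomial.C lam * MvPolynomial.X 0 : Fin 1 → MvPolynomial (Fin 1) ℚ)).congr
      fun x _ => ?_
    funext j
    simp [hΦ]
  have hΦmaps : MapsTo Φ {x : Fin 1 → ℝ | x 0 ∈ Icc (0 : ℝ) 1} slab := by
    intro x hx
    simp only [hΦ, hslab, mem_setOf_eq, mem_Icc]
    have h0 := hx.1
    have h1 := hx.2
    have hαα₂ : (α : ℝ) < α₂ := (hVU α₂ ⟨hα₂l, by linarith⟩).1
    have hβ₂β : (β₂ : ℝ) < β := (hVU β₂ ⟨by linarith, hβ₂r⟩).2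
    have hlamR : (lam : ℝ) = β₂ - α₂ := by rw [hlam]; push_cast; ring
    constructor <;> nlinarith
  have hFΦ : IsSemialgebraicFunOn ℚ {x : Fin 1 → ℝ | x 0 ∈ Icc (0 : ℝ) 1} (F ∘ Φ) :=
    IsSemialgebraicFunOn.comp_isSemialgebraicMapOn_holds hF hΦsa hΦmaps
  -- the rescaled primitive has derivative `1/(s − x₀)`, `x₀ = (5 − α₂)/λ > 1`, on `(0, 1)`
  set x₀ : ℝ := (5 - α₂) / lam with hx₀
  have hx₀1 : 1 < x₀ := by
    rw [hx₀, lt_div_iff₀ hlam0]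
    have hβ₂4 : (β₂ : ℝ) < 4 := ((hVU β₂ ⟨by linarith, hβ₂r⟩).2).trans hβ4
    have hlamR : (lam : ℝ) = β₂ - α₂ := by rw [hlam]; push_cast; ring
    linarith
  have hG : ∀ s ∈ Ioo (0 : ℝ) 1,
      HasDerivAt (fun s : ℝ => (F ∘ Φ) (fun _ => s)) (1 / (s - x₀)) s := by
    intro s hs
    have hlamR : (lam : ℝ) = β₂ - α₂ := by rw [hlam]; push_cast; ring
    have hts : (α₂ : ℝ) + lam * s ∈ Ioo (t₁ - ε) (t₁ + ε) := by
      constructor <;> nlinarith [hs.1, hs.2]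
    have h1 : HasDerivAt (fun s : ℝ => (α₂ : ℝ) + lam * s) ((lam : ℝ) * 1) s :=
      ((hasDerivAt_id s).const_mul (lam : ℝ)).const_add (α₂ : ℝ)
    have h2 := (hderiv5 _ hts).comp s h1
    have heq : (fun s : ℝ => (F ∘ Φ) (fun _ => s)) = φ ∘ fun s : ℝ => (α₂ : ℝ) + lam * s := by
      funext s; simp [hφ, hΦ]
    rw [heq]
    refine h2.congr_deriv ?_
    have key : s - x₀ = ((α₂ : ℝ) + lam * s - 5) / lam := by
      rw [hx₀]
      field_simp
      ring
    rw [key, one_div_div]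
    ring
  -- (9) the barrier: no `ℚ`-semialgebraic function on `[0,1]` has such a derivative
  obtain ⟨P, hP0, hPv⟩ :=
    Literature.Barriers.KontsevichZagierPeriods.KZ.NoSemialgPrimKernel.exists_ne_zero_evalEval_eq_zero hFΦ
  have hDN : ∀ t ∈ Ioo (0 : ℝ) 1,
      ((Polynomial.X - Polynomial.C x₀) * 1 : Polynomial ℝ).eval t * (1 / (t - x₀)) =
        (1 : Polynomial ℝ).eval t := by
    intro t ht
    have hne' : t - x₀ ≠ 0 := fun h0 => by linarith [sub_eq_zero.1 h0, ht.2.trans hx₀1]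
    simp only [mul_one, Polynomial.eval_sub, Polynomial.eval_X, Polynomial.eval_C, Polynomial.eval_one]
    field_simp
  exact hP0 (Literature.Barriers.KontsevichZagierPeriods.KZ.NoSemialgPrimKernel.eq_zero_of_evalEval_eq_zero
    (G := fun s : ℝ => (F ∘ Φ) (fun _ => s)) (V := 1) (N := 1) (x₀ := x₀) hG hDN
    (by simp) (by simp) P.natDegree P le_rfl (fun t ht => hPv t (Ioo_subset_Icc_self ht)))


/-! ## §1 Strength and where the barriers bite (pointers; the theorems are in the Strength file)

`KontsevichZagierPeriods → ResidualBeyondGenusZero`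
(`ResidualBeyondGenusZero.residualBeyondGenusZero_of_kontsevichZagierPeriods`), so `¬ crux` refutes
the summit; the obstruction form (`…_iff_invariant`, Forms file) says a refutation IS an additive
invariant of the four move sets vanishing on `gzSet` and not on `ker eval`. Combinatorial invariants
are excluded a priori: `FormalRep ⧸ relations` is divisible and torsion-free, so every `ℤ`-valued or
finite-valued move-invariant vanishes (sibling work file Cruxes/SectorComplement/Disproof.lean §4c,
tree `MultiplicationAccessible.Negative.mem_relations_of_nsmul_mem_relations`). The strength
barriers of `Literature/Barriers/KontsevichZagierPeriods/` are consequences of the summit, hence of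
crux ∧ sector cruxes: -/

/-- The residual plus the genus-zero KERNEL (every vanishing genus-zero combination is a relation —
what the sector cruxes of the route supply, in whatever decomposition the planner currently files:
`DihedralNormalForm` + `MzvKernelInKZ`, or + `HoffmanSpanInKZ` + `HoffmanIndependence` after the
2026-08-16 repair) give the kernel conjecture. Stated against the kernel so that it does not depend
on the shape of the route's `closes`. -/
theorem kzKernel_of_residual_of_gzKernel (hRES : ResidualBeyondGenusZero)
    (hGZ : ∀ c₀ ∈ AddSubgroup.closure gzSet, KZ.eval c₀ = 0 → c₀ ∈ KZ.relations) :
    KZKernelConjecture := by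
  intro c hc
  obtain ⟨c₀, hc₀, hcc₀⟩ := residual_iff.1 hRES c hc
  have h0 := (AddMonoidHom.mem_ker).1 (KZ.relations_le_ker_eval_holds hcc₀)
  rw [map_sub, hc, zero_sub, neg_eq_zero] at h0
  have := add_mem hcc₀ (hGZ c₀ hc₀ h0)
  rwa [sub_add_cancel] at this

/-- **The barrier bite on this item**: granted the genus-zero kernel, the residual proves that
`ζ(5)` is irrational AND that every odd zeta value `ζ(2k+1)`, `k ≥ 1`, is irrational — both open —
modulo the printed implication "period conjecture ⇒ algebraic independence of the odd zeta values"
(`kzConjecture_implies_oddZetaAlgIndep`, Huber–Wüstholz 2022, Prologue; tree theorems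
`zetaFiveIrrational_of_kz`, `oddZetaIrrational_of_kz`). Stated as a conjunction so that no tool
mistakes it for a proof of either named conjecture. -/
theorem residual_bites_oddZeta
    (hB : Literature.Barriers.KontsevichZagierPeriods.kzConjecture_implies_oddZetaAlgIndep)
    (hRES : ResidualBeyondGenusZero)
    (hGZ : ∀ c₀ ∈ AddSubgroup.closure gzSet, KZ.eval c₀ = 0 → c₀ ∈ KZ.relations) :
    ZetaFiveIrrational ∧ OddZetaIrrational :=
  have hS := kzKernelConjecture_iff_isRational.1 (kzKernel_of_residual_of_gzKernel hRES hGZ)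
  ⟨Literature.Barriers.KontsevichZagierPeriods.zetaFiveIrrational_of_kz hB hS,
    Literature.Barriers.KontsevichZagierPeriods.oddZetaIrrational_of_kz hB hS⟩

end Summit.KontsevichZagierPeriods.KontsevichZagierPeriods.Cruxes.ResidualBeyondGenusZero.Disproof
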